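import Literature.MathematicalPhysics.QuantumFieldTheory.Balaban1983to89.Beta.BalabanStepJets
import Literature.MathematicalPhysics.QuantumFieldTheory.Balaban1983to89.Beta.HessianTelescopingKKT
import Literature.MathematicalPhysics.QuantumFieldTheory.Balaban1983to89.Beta.ResolventComposition

/-!
# `Balaban1983to89.Beta.BalabanCompositeJets` — the composite («one-shot») jets `Jc m : JetData d (Lc^m)` of the road (D-μ):
# the first-order composite stencil family DEFINED by a transport-free level recursion from tree pieces, (K1b′) at the vertex
# level (the one-shot chain-rule vertex transports itself, with an4's `wStep` as weight), block-translation covariance, and the base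
# identification `TshotOf Lc Jc 1 = TbalOf Lc Js 0`; (v1.2) the one-shot SECOND-ORDER vertex of a fine bi-stencil family and its
# (K1b′ ⊗ K1b′) self-transport; (v1.3) its localisation — the `JetData.loc₂` socket; (v1.4, docstring-only) the RULING (R29)
# identification clause: (1.22) is reached on the Π_tree-DRESSED `JsBal`, slice and residual group NAMED
# (v1.5, docstring-only) the (A3) SENTENCE: the completed family BY CONSTRUCTION (`JsBal N Lc := fun j ↦ AxialDressing.dress
# (JsBal⁰ N Lc j)`, each member's typed kernel in closed form by `AxialDressing.TOf_dress`) + the DICTIONARY rows (D-h), (D-h′) (deferred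
# to P5′), (D-i) (certificates BY NAME)

HONEST FRAMING (cell `pub-balaban`, β-function road; verbatim): «discharging BetaPertH makes Balaban's UV stability UNCONDITIONAL —
a real constructive-QFT result; it is NOT the continuum limit and NOT the Clay problem.»  ABSOLUTE RULE (verbatim): «No
internally-minted statement may enter as a cited fact. Every hypothesis is either kernel-proved in this package or a verbatim
quotation of a PUBLISHED theorem with page reference. The manuscript(s) under audit are NOT citable for their own disputed steps —
they are the thing under adjudication; programme-internal (2001/route/tribunal) claims are never citable.»  This file cites NOTHING:
every declaration is a definition or a kernel-checked lemma about definitions ([folklore] tags throughout); no `Prop` mirrors a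
printed claim; the road's named open statements ((SDF), P6c, `D1Sum`, `K1aTrans`, `D1Rep`) do not occur here, neither as
hypotheses nor as conclusions (RULING (R28-3)).

WHAT THIS IS.  The road to `OneStepKernelFamily.D1Drift Lc (JsBal N Lc) N μ ν` ((R27)/(R28): binders `StepDriftWitness.D1Sum Lc JsBal
JcRec μ ν` and `OneStepKernelFamily.D1Rep Lc JcRec N μ ν …`) needs, next to Bałaban's STEP jets `Js j : JetData 3 Lc` (staging object
`BalabanStepJets.jsBal0Of`, an2 gen 8), the COMPOSITE jets `Jc m : JetData 3 (Lc^m)` of the `Lc^m`-fold («one-shot») system, read by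
`OneStepKernelFamily.TshotOf Lc Jc m := TOf (N := Lc^m) (Jc m)`, and the base identification `hbase : TshotOf Lc Jc 1 = TbalOf Lc Js 0`
of an4's `HessianTelescopingKKT.secondMomentSum_of_stepRecursionUpTo_wStep` / the lead's `StepDriftWitness.d1Sum_of_stepDefect`.  This
leaf is the STAGING OBJECT for `Jc` («JcRec» of the journal), in the same sense as `jsBal0Of`: the FIRST-ORDER composite stencil family
`Sc n` (composite level `n+1`) is DEFINED, by an explicit level recursion from tree pieces carrying the SAME three real weights
`cE cVH cΛ` as the first-step stencil `BalabanStepJets.S0` (no new real parameter — binder-violation list of the lead's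
IDENT-122-CHECKLIST v0.2); the SECOND-ORDER composite families are ABSTRACT (`W m`, bi-localised — the P4 node: transported (V-V) tables,
lifted step second jets and the inter-level cross terms are not typed here); `hbase` is PROVED.

IDENTIFICATION WITH (1.22) IS SUBJECT TO RULING (R29) (v1.4, docstring-only; journal RULING (R29) 2026-08-19T16:05:08Z, lead ANSWER
16:09:12Z (q1)–(q3), IDENT-122-CHECKLIST v0.4 rows (D-e)/(D-g)/(D-h)).  The families of this file (`Sc`, `jcOf`, `vertex2Of`, the
(K1b′) transport identities) are CONSTRUCTIONS ON ABSTRACT `JetData` / stencil data and assert no identification with print.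
Bałaban's `Π_{j+1}` of (1.20)–(1.22) is `Hess₀E_orbit` — one loop of the ORBIT functional, realised by a NAMED sharp `B`-independent
slice PLUS that slice's Faddeev–Popov quotient — and on this road it is reached on the `Π_tree`-DRESSED step jets
`JsBal N Lc := fun j ↦ AxialDressing.dress (JsBal⁰ N Lc j)` (route (α), SAME type `ℕ → JetData 3 Lc`, the typed weak-Landau resolvent
`KInv` kept, the slice change carried by the jets through `Πᵀ = AxialProjector.coProj`; wall statement
`OneStepKernelFamily.D1Drift Lc (JsBal N Lc) N μ ν` literally unchanged), NOT on the ghost-less weak-Landau families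
`TbalOf Lc (JsBal⁰ N Lc)` / `TshotOf Lc (jcOf …)` as they stand (those omit the ghost loop `Hess₀ log|det(τ_N·D_B)↾𝔫_ev|` of the
typed slice `τ_N`).  THE SLICE NAMED (row (D-h)): `τ_tree` := the block-tree AXIAL rows — the field vanishes on the bonds of the
comb tree of each `Lc`-block (an1 `AveragingContours.AxialGauge`/`treeGauge`, rooted at the block base point `Lc•y`; Bałaban roots
at the centre, [Balaban1985UV3] p.258 (9) and [Balaban1985BackgroundPropagators] p.428 (3.156) «B = 0 on ∪ Ax(y)», quoted in
`Literature/…/Balaban1983to89/B10.lean` and in `Beta.TreeSliceUnipotent`'s header — a conjugation by a fixed in-block translation,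
immaterial for unipotency and finite range); the residual group is the EVALUATION type `G₀ = {u : u(y) = 1 at the base points}`
([Balaban1987RG1] p.254, quoted in `Beta.GaugeFixing`); `τ_tree` is unipotent (`Beta.TreeSliceUnipotent`
`abs_linearMapDet_eq_one_of_forest_formula` / `abs_det_forestMatrix_comb_eq_one`, BY NAME — never re-proved here), so its FP quotient is
`≡ 1` and no ghost family is carried.  The averaging-side dictionary at `U = 1` is `AxialProjector.linAvg_eq_contourSum_axProj` / an1
node 11 `AveragingAxialDictionary` (`𝔫_av` never enters).  All locators in this paragraph point at OTHER modules' verbatim quotations;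
nothing printed is asserted here.

THE (A3) SENTENCE (v1.5, docstring-only; the β-lead's WORK-ORDER of 2026-08-19T17:11:33Z item (P2), form «BY CONSTRUCTION + dictionary»
chosen by an2 (2026-08-19, journal) and accepted; 0 `Prop`, no declaration added, nothing printed asserted; every name below is ANOTHER module's
kernel-checked declaration or this file's, cited BY NAME and never restated).
(A3-1) THE COMPLETED ONE-LOOP FAMILY, BY CONSTRUCTION.  The road's family is `OneStepKernelFamily.TbalOf Lc (JsBal N Lc)` with the LITERAL
`JsBal N Lc := fun j ↦ AxialDressing.dress (JsBal⁰ N Lc j)` — the dressing functor `AxialDressing.dress : JetData d N → JetData d N` applied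
ONCE per member (never iterated, never mixed with an undressed member); `JsBal⁰ N Lc 0` is `BalabanStepJets.jsBal0Of …` and the members
`JsBal⁰ N Lc j`, `j ≥ 1`, are OWED (work-order (P3): the step jets at level `j` through `Sc`/`jcOf` of this file; until then the wall statement
`OneStepKernelFamily.D1Drift Lc (JsBal N Lc) N μ ν` is not a closed term and NOTHING is discharged).  By an2's kernel theorem
`AxialDressing.TOf_dress` (leaf `Beta.AxialDressing` v1.3, §9; localisation-only hypotheses — it holds for EVERY `J : JetData d N`) each
member's typed kernel has the closed form `TOf (dress J) = hessKer (AxialDressing.axDressK N KInv) (AxialDressing.axVertexOf J.S) J.W`: the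
resolvent Hessian kernel of the `Π`-CONJUGATED typed weak-Landau resolvent (`Γ_tree = Π Γ Πᵀ`, `Π = AxialProjector.axProj N`) with the
UNDRESSED second-order tables and the chain-rule vertex of the UNDRESSED stencils over `ℋ_tree = Π ℋ` (tadpole half
`AxialDressing.tadpole_dressK`, bubble half `AxialDressing.bubble_dressK`; finite-dimensional model: an5
`SliceComposition.toCols₁_minOp_sliceChange` / `blocks_comp_sliceChange`).  SIGN DICTIONARY (conventions, no theorem links the two
levels): `ExpKernelCalculus.hessKer A V W μ ν z = ½·tadpole A (W μ 0 ν z) − ½·bubble A (V μ 0) (V ν z)` is the ACTION-sign one loop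
(`+½ log det`); the finite models `OneLoop.polarization` / `OrbitPolarization.orbitPol` are `log Z`-sign Hessians — entry `hessKer ↔ −polarization`.
(A3-2) ROW (D-h), THE SLICE AND THE RESIDUAL GROUP: `τ_tree` and `G₀` exactly as named in the preceding paragraph — the block-tree axial rows
of the comb rooted at the block base point `N•y` with axis order `0 < 1 < … < d` (an1 `AveragingContours.treeGauge`, `AxialProjector.InPath`;
Bałaban's centre root differs by a fixed in-block translation), `G₀` the EVALUATION type `{u : u(y) = 1 at the base points}`, unipotency
`TreeSliceUnipotent.abs_det_forestMatrix_comb_eq_one` BY NAME (FP quotient `≡ 1`, no ghost family carried).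
(A3-3) ROW (D-h′), TREE-INDEPENDENCE / REFLECTION: DEFERRED to the P5′ road (the reflection hypothesis `hR` for the DRESSED family), where it
is reached through tree-independence of the orbit one loop — model: the lead's `OrbitPolarization.polarization_eq_of_forests` (two forest
slices under II′'s hypotheses read the same polarization); the closed form of the failure of the AVERAGED-over-trees alternative is lit1's
`Beta.AveragedTransportVariance`.  This file and `AxialDressing` dress by ONE tree and assert no reflection lemma.
(A3-4) ROW (D-i), «THE TYPED JETS ARE THE TAYLOR COEFFICIENTS TO SECOND ORDER OF A `G₀`-INVARIANT CONSTRAINED SYSTEM» — certificates BY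
NAME, orders 0 and 1 (RULING ADDENDUM (R29-9), the lead's refinement of 2026-08-19T16:53:18Z).  Q-side (K-c), an1
`AveragingAxialDictionary`: (B⁰) `linAvg_grad_of_base` (a residual-algebra gauge mode averages to zero), (B¹)
`vhU_grad_add_linAvg_gmode1_of_base` (the `B`-linear letter of `Q(B)·W(B)λ` vanishes on `𝔫_ev`) with its exponential-chart companion
`hessU_grad_left_of_base`; at `U = 1` the averaging dictionary is `AxialProjector.linAvg_eq_contourSum_axProj` / `axProj_grad`.  K-side:
(K-a) an3's exact per-plaquette identity (E) for the Wilson jets, IN KERNEL to order `B¹` as `WilsonWardJets.ward21` / `ward20` /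
`jet21_ward` / `jet11_gaugeDir₀` (order `B²`: `WilsonWardJets2.ward12` / `jet12_ward` is the down payment; the full order-2 identity and
the matrix/(I1) bridge ride WITH P4); (K-b) the current/multiplier identity of the constrained critical point `J(B̃) = Q(B̃)ᵀ ω(B̃)` — owner:
the Λ/(V-J) piece `cΛ • SLam N (lamCoeffOf (KInv N) N) hessFF` of an2's `BalabanStepJets.S0` (the Lagrange legs enter through `Qᵀ` by the
definition of `InterLevelTransport.SLam`), finite model an5 `ResolventCompositionStepB.decomposition_of_EL` / `VF_EL`; the assembled
Lagrangian identities `K₁W₀ + K₀W₁ = 0`, … are an1's `LagrangianGaugeDegeneracy.lagrangianHessian_mul_W` under its hypotheses.  ORDER 2 IS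
OWED WITH P4 (an1 node 12 `AveragingThirdJet` `T₂`; an3 `WilsonVertex2Sym` / `WilsonWardJets2`).  (D-i) is the lead's tick on this header;
this file proves nothing about it.

THE DESIGN FINDING THAT SHAPES THE RECURSION (X-an2-34; kernel-checked as `vertexOf_eq_transportV`, §7).  The one-shot kernel reads a
stencil family `S` through the chain-rule vertex `OneStepResolventKernel.vertexOf (N := N) S μ z = Σ_{κ′} Σ'_u ℋ_N(κ′, u; μ, z) • S κ′ u`
(weights = the minimiser column of the `N`-fold packed resolvent).  an5's reproduction theorem `ResolventComposition.wH_reproduction` —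
the content of (K1b′), `ResolventComposition.k1b'`, TRUE at every step — says `ℋ_{ML}(·; μ, z) = Σ_{(l″,w′)} (𝒬_M ℋ_{ML}(·; μ, z))(l″, w′) ·
ℋ_M(·; l″, w′)`.  Hence (§7) for EVERY local stencil family and every commensurate pair `N′ = M·L`:
`vertexOf (N := N′) S = InterLevelTransport.transportV M (respStep M N′) (vertexOf (N := M) S)` — THE ONE-SHOT VERTEX TRANSPORTS
ITSELF, with response family `respStep M N′ (l″, w′ ← μ, z) := (𝒬_M ℋ_{N′}(·; μ, z))(l″, w′)` (= `(Lc^j)^{d+2} · KInvStep Lc j w′ (Lc•z)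
(inl l″) (inr μ)` for `M = Lc^j`, `N′ = Lc^{j+1}`, `respStep_eq`; at `d = 3` this is the `Lc^{5j}`-normalised column of an4's
`HessianTelescopingKKT.wStep` read at the relative position: `respStep (Lc^j) (Lc^{j+1}) μ z l″ w′ = wStep Lc j l″ μ (Lc•z − w′)`,
`respStep_eq_wStep`, §8, whence `StepDriftWitness.respBond Lc j = Lc^4 · respStep (Lc^j) (Lc^{j+1})`, `respBond_eq_mul_respStep`).  CONSEQUENCE: the inter-level transport of FIRST jets
(`InterLevelTransport.transportV`, the bond-unit response `StepDriftWitness.respBond`) belongs to the vertex-level THEOREM, not to the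
DEFINITION of the composite jets: the level recursion is written at STENCIL level and is transport-free — only the multiplier legs of
the stencil move (the push `pushSum`, §1), plus the two increments of §2.  (RULING (R26-1) is respected: nothing here feeds a
transport; kernel fact `transportV_respBond_vertexOf` (§8, `d = 3`): transporting the level-`Lc^j` one-shot vertex family of ANY local
stencil family by the lead's `respBond Lc j` gives `Lc^4 •` its level-`Lc^{j+1}` one-shot vertex family — `respBond = Lc^4 • wStep` =
(the jets' own rescaling `Lc^{d+1}`, below) × (the (K1b′) weight).)

UNITS (the three exponents of `Sc_succ`; a DERIVATION recorded for the lead's (c″) tick — certified only by the future proof of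
the step recursion (R1) against an4's `StepRecursionUpTo`, NOT by anything in this file).  Conventions of the package: the typed
multiplier of `KInv (N := N)` is dual to the block SUM `b^{sum} = N^{d+2} · (block mean)`; Bałaban's coarse field in coarse lattice
units is `B̃ = N · (block mean)`, so `b^{sum} = N^{d+1} · B̃` and a `B̃`-derivative is `N^{d+1}` typed multiplier derivatives (this is
(R1)'s factor `(Lc:ℝ)^8 = Lc^{2(d+1)}` at `d = 3` per step and pair of legs).  The `(n+2)`-fold composite constraint is the composition
`Q_{Lc^{n+2}} = Q_{Lc} ∘ Q_{Lc^{n+1}}` (block means compose; `AffineAveraging.contourSum_mul`), so in SUM normalisation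
`b^{sum}_{n+2} = Lc^{-(d+1)} · pushSum`-of-`b^{sum}_{n+1}` on the linear part, whence, for the bordered Hessian `𝕄_{m+1}` of the
`(m+1)`-fold system written over the `m`-fold one (`m = n+1`): (i) the field block and the border transported by the linearised one-step
averaging pick up `Lc^{d+1}` per pushed multiplier leg-pair normalisation — the factor `(Lc:ℝ)^(d+1)` of the first summand (uniform on
the pushed stencil, field block included, because the composite stencil is read against `KInv (N := Lc^{m+1})` whose field block is
the SAME fine operator); (ii) the NEW border piece — the second derivative `Q″_{Lc}` of the one-step averaging evaluated on the level-`m`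
block field, one field leg through `Q′_mᵀ` — carries `(Lc^m)^{d+2}` (one block-sum normalisation of the level-`m` mean): the factor of
`borderInc`; (iii) the NEW Lagrange piece `λ_{m+1} · Q″_{Lc}[Q′_m ·, Q′_m ·]` carries `(Lc^m)^{2(d+2)}`: the factor of `lagrInc`.  The
level-`m` Lagrange structure `λ_m Q″_m` re-expressed through `λ_m = λ_{m+1} ∘ Q′_{Lc}` is already inside the pushed stencil (its
multiplier legs are pushed with the rest).  If (R1)'s proof forces other exponents, `Sc` is re-weighted THERE (three numerals), and
nothing else in this file changes (`locStencil_Sc`, `Sc_antisymm`, `Sc_translate`, `jcOf`, `hbase`, §7–§8 are exponent-agnostic).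

CONTENT (general `d` except §5).  §1 `pushSet/pushPt/pushInd/pushSum M L K` — the one-step push of the multiplier legs of a kernel from
the `M`-lattice to the `(M·L)`-lattice by the unnormalised linearised contour sum `(Q′_L)ᵀ` (field legs untouched) — and
`biLoc_pushSum` (bi-localisation survives, rate unchanged, constant `× (L^{d+2})² e^{4(d+1)MLδ}`).  §2 `biLoc_recenter`; the lattice
vector `bshift`; `borderInc d Lc M κ u := Σ_{s<M} avgLift M (mfNeg (vhS d Lc κ (quo M (u − s e_κ))))` (an1's one-step field–multiplier
kernel on the `M`-lattice through the (R26-3) block-sign adapter, summed over the `M` level-`M` bonds whose straight contour passes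
through the fine bond `(κ,u)`, pulled back by an2's `InterLevelTransport.avgLift`) and `lagrInc d Lc M N′ κ u := SLam N′ (lamCoeffOf
(KInv N′) N′) (avgLift M ∘ hessFF Lc)`; `locStencil_borderInc` (every rate), `locStencil_lagrInc` (some rate, `N′ = M·Lc`).  §3 THE
RECURSION `Sc d Lc cE cVH cΛ : ℕ → stencil family`, `Sc 0 = S0 d Lc cE cVH cΛ`, `Sc (n+1) κ u = Lc^{d+1} • pushSum (Lc^{n+1}) Lc (Sc n κ u)
+ (cVH·(Lc^{n+1})^{d+2}) • borderInc d Lc (Lc^{n+1}) κ u + (cΛ·(Lc^{n+1})^{2d+4}) • lagrInc d Lc (Lc^{n+1}) (Lc^{n+2}) κ u` (`Sc_zero`,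
`Sc_succ`); `locStencil_Sc` (every level is a local stencil family, by induction).  §4 `jcOf hLc cE cVH cΛ W Cw δw hδw hW m : JetData d
(Lc^m)` (first-order part `Sc … (m−1)`, second-order part the given `W m`; level `0` a dummy member — the road reads `m ≥ 1`),
`jcOf_S`, `jcOf_W`, `jcOf_one_S`.  §5 (`d = 3`) `tshotOf_one_eq_tbalOf_zero` (abstract `hbase` from equality of the `m = 1` / `j = 0`
parts, via an4's `tbalOf_zero` and `vertexOfK_KInv` across the cast `Lc^1 = Lc`), `tshotOf_jcOf_one`, `tshotOf_jcOf_one_jsBal0Of`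
(the instance with `Js 0 = jsBal0Of …`), `vertexFamily₂_W_one`.  §6 `Sc_antisymm` — the stripping convention (antisymmetry on the
packed fibre, `StepJetData` §5) survives the recursion (`pushSum_antisymm`, `avgLift_antisymm`, `borderInc_antisymm`,
`lagrInc_antisymm`, an2's `S0_antisymm`).  §7 `respStep`, `respStep_eq`, `summable_respStep`, `summable_contourSum`, `abs_tsum_mul_le`,
**`vertexOf_eq_transportV`** ((K1b′) at the vertex level, every `N′ = M·L`, every local stencil family) and its consecutive-level
instance `vertexOf_pow_succ`.  §6b (v1.1) `pushSum_translate`, `borderInc_translate`, `lagrInc_translate`, **`Sc_translate`**: every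
composite level is block-translation covariant under ITS coarse lattice, `Sc n κ (u + Lc^{n+1}•t) = shiftK (−Lc^{n+1}•t) (Sc n κ u)` — the
`covS` socket of `OneStepKernelFamily.vertexOfK_translate` / `OneStepResolventKernel.blockCovariant_KInv` at blocking `Lc^{n+1}` (from
an2's `S0_translate`, an1's `vhS_translate`/`hessFF_translate`, `SLam_translate`, `avgLift_shiftK`).  §8 (v1.1, `d = 3`)
**`respStep_eq_wStep`**, `vertexOf_pow_succ_wStep`, `respBond_eq_mul_respStep`, **`transportV_respBond_vertexOf`** — the (K1b′)
response family between consecutive composite levels IS an4's `wStep Lc j` at the relative position, i.e. EXACTLY the weight the road's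
step recursion (R1) (`HessianTelescopingKKT.StepRecursionUpTo … (wStep Lc)`) and the lead's response slot (`respBond = Lc^4 • wStep`,
`StepDriftWitness.respBond_eq_wStep`) are stated with.  §9 (v1.2) `LocStencil₂` (local fine BI-stencil family `S₂ κ u κ′ u′`: a
kernel per ordered pair of fine bonds, bi-localised at the first bond with a constant decaying in the bond separation — the shape of a
fine second-order table), **`vertex2Of N S₂ μ z ν z′`** (the one-shot SECOND-ORDER vertex: both fine bond slots read through the
minimiser columns `ℋ_N` — the `ℋ⊗ℋ` part of a composite second `B`-jet), the slice bounds `summable_slice_of_locStencil₂`,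
`tsum_abs_slice_le`, `abs_vertexOf_slice_le`, `summable_vertexOf_slice`, the interchange `tsum_mul_tsum_comm`, §7 in general form
`vertexOf_eq_transportV_of_summable` (slice summability is all (K1b′) uses), and **`vertex2Of_eq_transportW`** ((K1b′ ⊗ K1b′): for
every local bi-stencil family and every `N′ = M·L`, `vertex2Of N′ S₂ = InterLevelTransport.transportW M (respStep M N′) (vertex2Of M S₂)`)
with its consecutive-level instance `vertex2Of_pow_succ` and (§8, `d = 3`) **`transportW_respBond_vertex2Of`** (`transportW (Lc^j)
(respBond Lc j) (vertex2Of (Lc^j) S₂) = Lc^8 • vertex2Of (Lc^{j+1}) S₂` — one bond-unit factor `Lc^4` per slot).  So the `ℋ⊗ℋ` part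
of the composite second order is, like the first order, a recursion at (bi-)STENCIL level; what remains of P4 is the second-RESPONSE
part (two minimiser responses / the second variation of the minimiser), (W-b) of the design record.  §10 (v1.3) `LocStencil₂.mono`,
`biLoc_wsum_far`, `biLoc_wsum_two` (weighted-sum localisation with a far / a second centre), `biLoc_vertexOf_slice`, and
**`vertexFamily₂_vertex2Of`** / **`vertexFamily₂_vertex2Of'`**: the one-shot second-order vertex of a local bi-stencil family IS a
bi-localised vertex family at blocking `N` (`ExpKernelCalculus.VertexFamily₂ (vertex2Of N S₂) N Cv δv`, explicit constants resp. packaged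
with the rate of `KernelSpecInstance.decay_wH`) — the `loc₂` field of `OneStepResolventKernel.JetData`, so `ℋ⊗ℋ` tables may populate the
`W`-slot of the composite jets `jcOf`.

WHAT IS NOT HERE (named so that nobody reads it in).  (a) The composite SECOND-ORDER families (P4) and hence Bałaban's `Jc` itself —
`jcOf` takes them as data (v1.2 types the `ℋ⊗ℋ` carrier `vertex2Of` and its transport law, not the composite bi-stencil recursion nor
the second-response part); (b) the vertex-level STEP RECURSION (R1) (`HessianTelescopingKKT.StepRecursionUpTo … (wStep Lc)` for the
pair `(TbalOf Lc Js, TshotOf Lc Jc)`) and its long-range remainder `R_long` — by RULING (R28-2) P6c := «`secondMoment (R_long j) μ ν = 0`,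
`j ≥ 1`» is STATED by an2 once `R_long` is DEFINED, i.e. once the composite second-order structure is typed; it is therefore NOT stated
in this version, and (SDF)/`SD`/`SDInvisible`/`d1Sum_of_stepDefect` are the lead's (`StepDriftWitness` §8) and are not restated
(v1.4: by RULING (R29-3)/(R29-8) the P5′ `hW`/`hR`, P6c, `R_long` and (SDF) instances are aimed at the DRESSED pair
`(TbalOf Lc (JsBal N Lc), TshotOf Lc (dress ∘ jcOf …))` ONLY, never at the ghost-less families of this file; «P6c as a longitudinal
cancellation inside `hessKer`» is STRUCK — the inter-slice defect is the difference of the slices' ghost loops);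
(c) the members `j ≥ 1` of Bałaban's step jets and the weight pin (CONDITION (c), I-an2-34 — last); (d) any claim that the exponents of
`Sc_succ` are Bałaban's — see UNITS; (e) (v1.5) the (A3) sentence adds NO declaration: its certificates are the named modules', its
deferred rows ((D-h′), (D-i) order 2, (A4) hierarchical trees, the weight pin) are OWED as stated.  0 cited facts; 0 `Prop` mirrors; every
docstring tagged [folklore] states a definition or a lemma about definitions.
-/

open Finset
open scoped BigOperators
open Literature.MathematicalPhysics.QuantumFieldTheory
open Literature.MathematicalPhysics.QuantumFieldTheory.Balaban1983to89
open Literature.MathematicalPhysics.QuantumFieldTheory.Balaban1983to89.Beta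
open Literature.Probability.LatticeModels (Torus.proj)
open LatticeForm (quo proj_add_zsmul)
open BlochFibreUniqueness (quo_add_zsmul)
open B12Sec2to5 (l1 l1_nonneg)
open ExpKernelCalculus (Decays BiLoc VertexFamily VertexFamily₂ hessKer shiftK Zl Zl_nonneg l1_natSmul l1_sub_triangle l1_sub_symm)
open OneStepResolventKernel (Fib LocStencil JetData TOf vertexOf KInv decays_KInv proj_zsmul quo_zsmul eq_zsmul_quo_of_proj
  biLoc_mono biLoc_finset_sum l1_zsmul_sub_le shiftK_KInv bound_mono)
open OneStepKernelFamily (legSet legPt legPt_add legW LegIdx l1_legPt_sub_le legW_nonneg vertexOfK vertexOfK_KInv TbalOf TshotOf)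
open StepJetData (mfNeg mfNeg_shiftK locStencil_mfNeg locStencil_add locStencil_smul biLoc_smul biLoc_weaken)
open AveragingHessianKernels (vhS locStencil_vhS vhS_translate hessFF biLoc_hessFF hessFF_translate ell)
open InterLevelTransport (SLam locStencil_SLam SLam_translate cwsum avgLift biLoc_avgLift avgLift_shiftK)
open BalabanStepJets (lamCoeffOf abs_lamCoeffOf_le lamCoeffOf_translate S0 locStencil_S0 S0_translate locStencil_mono vertexFamily₂_mono)
open HessianTelescopingKKT (tbalOf_zero wStep stepCol stepCol_eq legOff)
open StepDriftWitness (sum_LegIdx_eq_contourSum)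
open ResolventComposition (Hcol Hcol_apply Hcol_bdd_summable wH_reproduction KInvStep_inl_inr)
open KernelWard (ProdBound tsum_comm_of_prodBound)
open KKTFluctuationEnergy (summable_mul_of_bdd summable_mul_of_bdd')
open AffineAveraging (contourSum Form1 box toSite unitVec)
open InterLevelTransport (transportV transportW cwsum_apply)
open KernelSpecInstance (wH decay_wH)
open OneStepResolventKernel (wsum)
open OneStepKernelFamily (KInvStep)

noncomputable section

namespace Literature.MathematicalPhysics.QuantumFieldTheory.Balaban1983to89.Beta.BalabanCompositeJets

variable {d : ℕ}

/-! ## §1 The one-step push of the multiplier legs (fine coordinates) -/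

section Push

/-- [folklore] Index set of the push per leg: a field leg is left in place (one index), a multiplier leg is summed over the
`L^{d+2}` points of the straight contours of the `L`-block (the index set `legSet d L (inl μ)` of `OneStepKernelFamily.dec`). -/
def pushSet (d L : ℕ) : Fib d → Finset ((Fin (d + 1) → ℕ) × ℕ)
  | Sum.inl _ => {(fun _ => 0, 0)}
  | Sum.inr μ => legSet d L (Sum.inl μ)

/-- [folklore] The points of the push (fine coordinates, current coarse scale `M`, one more blocking by `L`): a field leg at `x`
stays at `x`; a multiplier leg at the new coarse point `x = (M·L)•z` is read at the fine images `M • (L•z + r + s e_μ)` of the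
contour points of the `L`-block of `z` on the `M`-lattice. -/
def pushPt (M L : ℕ) : Fib d → (Fin (d + 1) → ℤ) → ((Fin (d + 1) → ℕ) × ℕ) → (Fin (d + 1) → ℤ)
  | Sum.inl _, x, _ => x
  | Sum.inr μ, x, i => (M : ℤ) • legPt L (Sum.inl μ : Fib d) (quo (M * L) x) i

/-- [folklore] The support indicator of the push per leg: `1` on field legs; on a multiplier leg `1` exactly at the points of the
new coarse lattice `(M·L)•ℤ^{d+1}`, else `0`. -/
def pushInd (M L : ℕ) : Fib d → (Fin (d + 1) → ℤ) → ℝ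
  | Sum.inl _, _ => 1
  | Sum.inr _, x => if Torus.proj (M * L) x = 0 then 1 else 0

/-- [folklore] **THE ONE-STEP PUSH OF THE MULTIPLIER LEGS** `pushSum M L K`: field legs untouched; every multiplier leg of `K`
(carried at the points `M•y` of the current coarse lattice) is pushed to the next coarse lattice `(M·L)•z` by the UNNORMALISED
linearised one-step contour sum `(Q′_L)ᵀ` (weight `1` per contour point; `L^{d+2}` points).  This is how the border (and, trivially,
the field block) of the `M`-fold composite bordered Hessian enters the `(M·L)`-fold one: `Q′_{ML} = Q′_L ∘ Q′_M` (UNITS below). -/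
def pushSum (M L : ℕ) (K : ExpKernelCalculus.MKer (d + 1) (Fib d)) : ExpKernelCalculus.MKer (d + 1) (Fib d) :=
  fun x w a b => pushInd M L a x * pushInd M L b w *
    ∑ i ∈ pushSet d L a, ∑ i' ∈ pushSet d L b, K (pushPt M L a x i) (pushPt M L b w i') a b

/-- [folklore] PIN: the field–field block is untouched by the push. -/
theorem pushSum_inl_inl (M L : ℕ) (K : ExpKernelCalculus.MKer (d + 1) (Fib d)) (x w : Fin (d + 1) → ℤ) (α β : Fin (d + 1)) :
    pushSum M L K x w (Sum.inl α) (Sum.inl β) = K x w (Sum.inl α) (Sum.inl β) := by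
  simp only [pushSum, pushInd, pushSet, pushPt, Finset.sum_singleton, one_mul]

/-- [folklore] The indicator takes the values `0` and `1` only. -/
theorem pushInd_eq (M L : ℕ) (a : Fib d) (x : Fin (d + 1) → ℤ) : pushInd M L a x = 0 ∨ pushInd M L a x = 1 := by
  rcases a with κ | μ
  · exact Or.inr rfl
  · by_cases h : Torus.proj (M * L) x = 0
    · exact Or.inr (by simp only [pushInd, h, if_true])
    · exact Or.inl (by simp only [pushInd, h, if_false])

/-- [folklore] The indicator is nonnegative. -/
theorem pushInd_nonneg (M L : ℕ) (a : Fib d) (x : Fin (d + 1) → ℤ) : 0 ≤ pushInd M L a x := by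
  rcases pushInd_eq M L a x with h | h
  · rw [h]
  · rw [h]; exact zero_le_one

/-- [folklore] The indicator is at most `1`. -/
theorem pushInd_le_one (M L : ℕ) (a : Fib d) (x : Fin (d + 1) → ℤ) : pushInd M L a x ≤ 1 := by
  rcases pushInd_eq M L a x with h | h
  · rw [h]; exact zero_le_one
  · rw [h]

/-- [folklore] `|0|₁ = 0`. -/
theorem l1_zero' : l1 (0 : Fin (d + 1) → ℤ) = 0 := by
  simp only [l1, Pi.zero_apply, Int.cast_zero, abs_zero, Finset.sum_const_zero]

/-- [folklore] On the support of the indicator every push point lies within `ℓ¹`-distance `2(d+1)·M·L` of the leg's own point. -/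
theorem l1_pushPt_sub_le {M L : ℕ} [NeZero M] [NeZero L] (a : Fib d) (x : Fin (d + 1) → ℤ) {i : (Fin (d + 1) → ℕ) × ℕ}
    (hi : i ∈ pushSet d L a) (hx : pushInd M L a x ≠ 0) : l1 (pushPt M L a x i - x) ≤ 2 * (d + 1) * M * L := by
  rcases a with κ | μ
  · simp only [pushPt, sub_self, l1_zero']
    positivity
  · have hproj : Torus.proj (M * L) x = 0 := by
      by_contra h
      exact hx (by simp only [pushInd, h, if_false])
    have ex : x = ((M * L : ℕ) : ℤ) • quo (M * L) x := eq_zsmul_quo_of_proj (N := M * L) hproj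
    have hleg := l1_legPt_sub_le L (Sum.inl μ : Fib d) (quo (M * L) x) hi
    have e : pushPt M L (Sum.inr μ) x i - x = (M : ℤ) • (legPt L (Sum.inl μ : Fib d) (quo (M * L) x) i - (L : ℤ) • quo (M * L) x) :=
      calc pushPt M L (Sum.inr μ) x i - x
          = (M : ℤ) • legPt L (Sum.inl μ : Fib d) (quo (M * L) x) i - ((M * L : ℕ) : ℤ) • quo (M * L) x := by
            rw [← ex]; rfl
        _ = (M : ℤ) • (legPt L (Sum.inl μ : Fib d) (quo (M * L) x) i - (L : ℤ) • quo (M * L) x) := by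
            rw [smul_sub, Nat.cast_mul, mul_smul]
    rw [e, l1_natSmul]
    have hM : (0 : ℝ) ≤ M := Nat.cast_nonneg M
    calc (M : ℝ) * l1 (legPt L (Sum.inl μ : Fib d) (quo (M * L) x) i - (L : ℤ) • quo (M * L) x)
        ≤ (M : ℝ) * (2 * (d + 1) * L) := mul_le_mul_of_nonneg_left hleg hM
      _ = 2 * (d + 1) * M * L := by ring

/-- [folklore] The push index sets have at most `L^{d+2}` elements (exactly `1` on a field leg). -/
theorem card_pushSet_le {L : ℕ} (hL : 1 ≤ L) (a : Fib d) : ((pushSet d L a).card : ℝ) ≤ (L : ℝ) ^ (d + 2) := by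
  rcases a with κ | μ
  · simp only [pushSet, Finset.card_singleton, Nat.cast_one]
    exact one_le_pow₀ (by exact_mod_cast hL)
  · simp only [pushSet, legSet, LegIdx, Finset.card_product, Fintype.card_piFinset, Finset.card_range, Finset.prod_const,
      Finset.card_univ, Fintype.card_fin, Nat.cast_mul, Nat.cast_pow]
    exact le_of_eq (by ring)

/-- [folklore] **THE PUSH OF A BI-LOCALISED KERNEL IS BI-LOCALISED** at the same centres and the same rate, constant
`C·(L^{d+2})²·e^{4(d+1)·M·L·δ}` (each pushed leg moves by at most `2(d+1)ML` in `ℓ¹` and is summed over at most `L^{d+2}` points). -/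
theorem biLoc_pushSum {M L : ℕ} [NeZero M] [NeZero L] (hL : 1 ≤ L) {K : ExpKernelCalculus.MKer (d + 1) (Fib d)}
    {p q : Fin (d + 1) → ℤ} {C δ : ℝ} (hK : BiLoc K p q C δ) (hδ : 0 ≤ δ) :
    BiLoc (pushSum M L K) p q (C * ((L : ℝ) ^ (d + 2)) ^ 2 * Real.exp (4 * (d + 1) * M * L * δ)) δ := by
  have hC : 0 ≤ C := hK.nonneg (Sum.inl 0)
  intro x w a b
  set E := Real.exp (-δ * (l1 (x - p) + l1 (w - q))) with hE
  -- termwise bound, indicator included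
  have hterm : ∀ i ∈ pushSet d L a, ∀ i' ∈ pushSet d L b,
      pushInd M L a x * pushInd M L b w * |K (pushPt M L a x i) (pushPt M L b w i') a b|
        ≤ C * Real.exp (4 * (d + 1) * M * L * δ) * E := by
    intro i hi i' hi'
    by_cases ha : pushInd M L a x = 0
    · rw [ha, zero_mul, zero_mul]; positivity
    by_cases hb : pushInd M L b w = 0
    · rw [hb, mul_zero, zero_mul]; positivity
    have h1 : pushInd M L a x * pushInd M L b w ≤ 1 := by
      calc pushInd M L a x * pushInd M L b w ≤ 1 * 1 :=
            mul_le_mul (pushInd_le_one M L a x) (pushInd_le_one M L b w) (pushInd_nonneg M L b w) zero_le_one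
        _ = 1 := one_mul 1
    have hk := hK (pushPt M L a x i) (pushPt M L b w i') a b
    have da := l1_pushPt_sub_le (M := M) (L := L) a x hi ha
    have db := l1_pushPt_sub_le (M := M) (L := L) b w hi' hb
    have ta : l1 (x - p) ≤ l1 (pushPt M L a x i - x) + l1 (pushPt M L a x i - p) := by
      have := l1_sub_triangle x (pushPt M L a x i) p
      rwa [l1_sub_symm x (pushPt M L a x i)] at this
    have tb : l1 (w - q) ≤ l1 (pushPt M L b w i' - w) + l1 (pushPt M L b w i' - q) := by
      have := l1_sub_triangle w (pushPt M L b w i') q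
      rwa [l1_sub_symm w (pushPt M L b w i')] at this
    have hexp : Real.exp (-δ * (l1 (pushPt M L a x i - p) + l1 (pushPt M L b w i' - q)))
        ≤ Real.exp (4 * (d + 1) * M * L * δ) * E := by
      rw [hE, ← Real.exp_add]
      exact Real.exp_le_exp.2 (by nlinarith)
    calc pushInd M L a x * pushInd M L b w * |K (pushPt M L a x i) (pushPt M L b w i') a b|
        ≤ 1 * (C * Real.exp (-δ * (l1 (pushPt M L a x i - p) + l1 (pushPt M L b w i' - q)))) :=
          mul_le_mul h1 hk (abs_nonneg _) zero_le_one
      _ ≤ C * Real.exp (4 * (d + 1) * M * L * δ) * E := by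
          rw [one_mul, mul_assoc]
          exact mul_le_mul_of_nonneg_left hexp hC
  have hind : 0 ≤ pushInd M L a x * pushInd M L b w := mul_nonneg (pushInd_nonneg M L a x) (pushInd_nonneg M L b w)
  have hca := card_pushSet_le (d := d) hL a
  have hcb := card_pushSet_le (d := d) hL b
  calc |pushSum M L K x w a b|
      = pushInd M L a x * pushInd M L b w *
          |∑ i ∈ pushSet d L a, ∑ i' ∈ pushSet d L b, K (pushPt M L a x i) (pushPt M L b w i') a b| := by
        rw [pushSum, abs_mul, abs_of_nonneg hind]
    _ ≤ pushInd M L a x * pushInd M L b w *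
          ∑ i ∈ pushSet d L a, ∑ i' ∈ pushSet d L b, |K (pushPt M L a x i) (pushPt M L b w i') a b| := by
        refine mul_le_mul_of_nonneg_left ?_ hind
        refine (Finset.abs_sum_le_sum_abs _ _).trans (Finset.sum_le_sum fun i _ => Finset.abs_sum_le_sum_abs _ _)
    _ = ∑ i ∈ pushSet d L a, ∑ i' ∈ pushSet d L b,
          pushInd M L a x * pushInd M L b w * |K (pushPt M L a x i) (pushPt M L b w i') a b| := by
        rw [Finset.mul_sum]
        refine Finset.sum_congr rfl fun i _ => ?_
        rw [Finset.mul_sum]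
    _ ≤ ∑ _i ∈ pushSet d L a, ∑ _i' ∈ pushSet d L b, C * Real.exp (4 * (d + 1) * M * L * δ) * E :=
        Finset.sum_le_sum fun i hi => Finset.sum_le_sum fun i' hi' => hterm i hi i' hi'
    _ = (pushSet d L a).card * ((pushSet d L b).card * (C * Real.exp (4 * (d + 1) * M * L * δ) * E)) := by
        rw [Finset.sum_const, nsmul_eq_mul, Finset.sum_const, nsmul_eq_mul]
    _ ≤ (L : ℝ) ^ (d + 2) * ((L : ℝ) ^ (d + 2) * (C * Real.exp (4 * (d + 1) * M * L * δ) * E)) := by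
        have h0 : 0 ≤ C * Real.exp (4 * (d + 1) * M * L * δ) * E := by positivity
        exact mul_le_mul hca (mul_le_mul_of_nonneg_right hcb h0) (by positivity) (by positivity)
    _ = C * ((L : ℝ) ^ (d + 2)) ^ 2 * Real.exp (4 * (d + 1) * M * L * δ) * E := by ring

end Push

/-! ## §2 Re-centring and the two level increments of the first-order composite stencil -/

section Increments

/-- [folklore] RE-CENTRING a diagonal bi-localisation bound costs the factor `e^{2δ·|p − q|₁}`. -/
theorem biLoc_recenter {K : ExpKernelCalculus.MKer (d + 1) (Fib d)} {p : Fin (d + 1) → ℤ} {C δ : ℝ} (h : BiLoc K p p C δ)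
    (hδ : 0 ≤ δ) (q : Fin (d + 1) → ℤ) : BiLoc K q q (C * Real.exp (2 * δ * l1 (p - q))) δ := by
  have hC : 0 ≤ C := h.nonneg (Sum.inl 0)
  intro x y a b
  have tx : l1 (x - q) ≤ l1 (x - p) + l1 (p - q) := l1_sub_triangle x p q
  have ty : l1 (y - q) ≤ l1 (y - p) + l1 (p - q) := l1_sub_triangle y p q
  calc |K x y a b| ≤ C * Real.exp (-δ * (l1 (x - p) + l1 (y - p))) := h x y a b
    _ ≤ C * (Real.exp (2 * δ * l1 (p - q)) * Real.exp (-δ * (l1 (x - q) + l1 (y - q)))) := by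
        refine mul_le_mul_of_nonneg_left ?_ hC
        rw [← Real.exp_add]
        exact Real.exp_le_exp.2 (by nlinarith)
    _ = C * Real.exp (2 * δ * l1 (p - q)) * Real.exp (-δ * (l1 (x - q) + l1 (y - q))) := by ring

variable (d)

/-- [folklore] The lattice vector `s • e_κ`. -/
def bshift (κ : Fin (d + 1)) (s : ℕ) : Fin (d + 1) → ℤ := fun j => if j = κ then (s : ℤ) else 0

variable {d}

/-- [folklore] `|s • e_κ|₁ = s`. -/
theorem l1_bshift (κ : Fin (d + 1)) (s : ℕ) : l1 (bshift d κ s) = s := by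
  simp only [l1, bshift]
  rw [Finset.sum_eq_single κ]
  · simp only [if_true, Int.cast_natCast, Nat.abs_cast]
  · intro j _ hj
    simp only [hj, if_false, Int.cast_zero, abs_zero]
  · intro h
    exact absurd (Finset.mem_univ κ) h

/-- [folklore] A point lies within `ℓ¹`-distance `(d+1)·M` of the base point `M • quo M x` of its `M`-block. -/
theorem l1_sub_zsmul_quo_le (M : ℕ) [NeZero M] (x : Fin (d + 1) → ℤ) : l1 (x - (M : ℤ) • quo M x) ≤ (d + 1) * M := by
  have h := l1_zsmul_sub_le (N := M) (quo M x) x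
  rw [sub_self, l1_zero', mul_zero, zero_add] at h
  rw [l1_sub_symm]
  linarith

/-- [folklore] The base point of the `M`-block of `u − s e_κ` (`s < M`) lies within `ℓ¹`-distance `(d+2)·M` of `u`. -/
theorem l1_sub_blockBase_le (M : ℕ) [NeZero M] (u : Fin (d + 1) → ℤ) (κ : Fin (d + 1)) {s : ℕ} (hs : s < M) :
    l1 ((M : ℤ) • quo M (u - bshift d κ s) - u) ≤ (d + 2) * M := by
  have h1 := l1_sub_zsmul_quo_le M (u - bshift d κ s)
  have h2 : l1 (u - (M : ℤ) • quo M (u - bshift d κ s))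
      ≤ l1 (u - (u - bshift d κ s)) + l1 ((u - bshift d κ s) - (M : ℤ) • quo M (u - bshift d κ s)) :=
    l1_sub_triangle _ _ _
  rw [sub_sub_cancel, l1_bshift] at h2
  rw [l1_sub_symm]
  have hs' : (s : ℝ) ≤ M := by exact_mod_cast hs.le
  linarith

variable (d)

/-- [folklore] **THE BORDER INCREMENT** at the passage from the `M`-fold to the `(M·Lc)`-fold composite (fine coordinates, without its
scalar weight): for the fine bond `(κ, u)`, the sum over the `M` straight contours of the `M`-lattice THROUGH `(κ, u)` — the level-`M`
bonds `(κ, z_s)`, `z_s = quo M (u − s e_κ)`, `s < M`, i.e. the support of the column `Q′_M(·; (κ,u))` of the linearised `M`-fold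
averaging — of an1's one-step field–multiplier kernel `mfNeg (vhS d Lc κ z_s)` on the `M`-lattice (the `U`-derivative of the one-step
averaging `Q′_{Lc}` evaluated on the level-`M` field, (R26-3) placement) pulled back to the fine legs by the averaging lift `avgLift M`
(field leg through `Q′_Mᵀ`, multiplier leg placed at the fine images `M•(Lc•y) = (M·Lc)•y` of the new coarse bonds). -/
def borderInc (Lc M : ℕ) (κ : Fin (d + 1)) (u : Fin (d + 1) → ℤ) : ExpKernelCalculus.MKer (d + 1) (Fib d) :=
  fun x w a b => ∑ s ∈ Finset.range M, avgLift M (mfNeg (vhS d Lc κ (quo M (u - bshift d κ s)))) x w a b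

/-- [folklore] **THE LAGRANGE INCREMENT** at the passage from the `M`-fold to the `N′ = M·Lc`-fold composite (without its scalar
weight): the abstract multiplier-curvature stencil `InterLevelTransport.SLam` at blocking `N′` with the multiplier response read off
the `N′`-fold packed resolvent (`BalabanStepJets.lamCoeffOf (KInv N′) N′` — the response of the multiplier of the `N′`-fold constraint
to a fine perturbation) and, as curvature kernels, an1's one-step constraint Hessians `hessFF Lc` on the `M`-lattice at the new coarse
bonds pulled back to the fine field legs by `avgLift M` (the term `Q_M′ᵀ · Q″_{Lc} · Q_M′` of `Q″_{N′} = Q″_{Lc}[Q_M′·, Q_M′·] + Q′_{Lc} Q_M″`;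
the second term is the level-`M` Lagrange structure, already inside the pushed stencil — UNITS below). -/
def lagrInc (Lc M N' : ℕ) [NeZero N'] (κ : Fin (d + 1)) (u : Fin (d + 1) → ℤ) : ExpKernelCalculus.MKer (d + 1) (Fib d) :=
  SLam N' (lamCoeffOf (KInv (N := N') (d := d)) N') (fun μ y => avgLift M (hessFF Lc μ y)) κ u

variable {d}

/-- [folklore] **THE BORDER INCREMENT IS A LOCAL STENCIL FAMILY** at every rate `δ ≥ 0` (an1's `vhS` is finite-range), constant
`M · 3ℓ(Lc)²·e^{4(d+1)·Lc·Mδ} · e^{4(d+1)·Mδ} · e^{2δ(d+2)M}`. -/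
theorem locStencil_borderInc {Lc M : ℕ} [NeZero M] (hLc : 1 ≤ Lc) {δ : ℝ} (hδ : 0 ≤ δ) :
    LocStencil (borderInc d Lc M)
      (M * (3 * (ell (d + 1) Lc : ℝ) ^ 2 * Real.exp (4 * ((d : ℝ) + 1) * Lc * (M * δ)) * Real.exp (4 * (d + 1) * (M * δ)) *
        Real.exp (2 * δ * ((d + 2) * M)))) δ := by
  have hM0 : (M : ℝ) ≠ 0 := by exact_mod_cast NeZero.ne M
  have hMδ : 0 ≤ (M : ℝ) * δ := mul_nonneg (Nat.cast_nonneg M) hδ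
  intro κ u
  set C0 := 3 * (ell (d + 1) Lc : ℝ) ^ 2 * Real.exp (4 * ((d : ℝ) + 1) * Lc * (M * δ)) * Real.exp (4 * (d + 1) * (M * δ)) with hC0
  have hC0nn : 0 ≤ C0 := by positivity
  have hterm : ∀ s ∈ Finset.range M,
      BiLoc (avgLift M (mfNeg (vhS d Lc κ (quo M (u - bshift d κ s))))) u u (C0 * Real.exp (2 * δ * ((d + 2) * M))) δ := by
    intro s hs
    set z := quo M (u - bshift d κ s) with hz
    have hG : BiLoc (mfNeg (vhS d Lc κ z)) z z
        (3 * (ell (d + 1) Lc : ℝ) ^ 2 * Real.exp (4 * ((d : ℝ) + 1) * Lc * (M * δ))) (M * δ) :=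
      locStencil_mfNeg (locStencil_vhS hLc hMδ) κ z
    have hA := biLoc_avgLift M hG hMδ
    rw [mul_div_cancel_left₀ δ hM0] at hA
    have hR := biLoc_recenter hA hδ u
    refine biLoc_weaken hR ?_ le_rfl
    refine mul_le_mul_of_nonneg_left (Real.exp_le_exp.2 ?_) hC0nn
    exact mul_le_mul_of_nonneg_left (l1_sub_blockBase_le M u κ (Finset.mem_range.1 hs)) (by positivity)
  have hsum := biLoc_finset_sum (Finset.range M) hterm
  simp only [Finset.sum_const, Finset.card_range, nsmul_eq_mul] at hsum
  exact hsum

/-- [folklore] **THE LAGRANGE INCREMENT IS A LOCAL STENCIL FAMILY** (some rate `δ > 0` — half the decay rate of `KInv N′`;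
existential at fixed `N′`, no uniformity claimed): `locStencil_SLam` fed with `abs_lamCoeffOf_le` + `decays_KInv (N := N′)` and an1's
`biLoc_hessFF` (taken at rate `M·δ`) through `biLoc_avgLift M` (rate back to `δ`), for `N′ = M·Lc`. -/
theorem locStencil_lagrInc {Lc M N' : ℕ} [NeZero M] [NeZero N'] (hLc : 1 ≤ Lc) (hN : N' = M * Lc) :
    ∃ C δ : ℝ, 0 < δ ∧ LocStencil (lagrInc d Lc M N') C δ := by
  obtain ⟨δ₀, C, hδ₀, hC, hdec⟩ := decays_KInv (N := N') (d := d)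
  have hM0 : (M : ℝ) ≠ 0 := by exact_mod_cast NeZero.ne M
  have hMδ : 0 ≤ (M : ℝ) * δ₀ := mul_nonneg (Nat.cast_nonneg M) hδ₀.le
  have hc := abs_lamCoeffOf_le (N := N') hdec hC hδ₀.le
  have hQ : VertexFamily (fun μ y => avgLift M (hessFF (d := d) Lc μ y)) N'
      (2 * (ell (d + 1) Lc : ℝ) ^ 2 * Real.exp (4 * ((d : ℝ) + 1) * Lc * (M * δ₀)) * Real.exp (4 * (d + 1) * (M * δ₀))) δ₀ := by
    intro μ y
    have hA := biLoc_avgLift M (biLoc_hessFF hLc μ y hMδ) hMδ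
    rw [mul_div_cancel_left₀ δ₀ hM0, ← mul_smul, ← Nat.cast_mul, ← hN] at hA
    exact hA
  have h3 := locStencil_SLam (N := N') hc hQ hδ₀ (mul_nonneg (mul_nonneg (by positivity) hC) (Real.exp_pos _).le)
  exact ⟨_, δ₀ / 2, by positivity, h3⟩

end Increments

/-! ## §3 The composite first-order stencil family `Sc n` (composite level `n + 1`) -/

section Composite

variable (d) (Lc : ℕ) [NeZero Lc]

/-- [folklore] **THE COMPOSITE FIRST-ORDER STENCIL FAMILY** of the `(n+1)`-fold composite system (fine coordinates; the jets of
`TshotOf … (n+1)`), DEFINED by the level recursion from tree pieces with the SAME three real weights `cE cVH cΛ` as the first-step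
stencil `BalabanStepJets.S0` (no new real parameter): `Sc 0 := S₀` and
`Sc (n+1) κ u := Lc^{d+1} • pushSum (Lc^{n+1}) Lc (Sc n κ u) + (cVH · (Lc^{n+1})^{d+2}) • borderInc d Lc (Lc^{n+1}) κ u
  + (cΛ · (Lc^{n+1})^{2d+4}) • lagrInc d Lc (Lc^{n+1}) (Lc^{n+2}) κ u`
(the UNIT EXPONENTS `d+1`, `d+2`, `2d+4` are derived in the module docstring; they are certified only by the future proof of the step
recursion (R1), not here). -/
def Sc (cE cVH cΛ : ℝ) : ℕ → Fin (d + 1) → (Fin (d + 1) → ℤ) → ExpKernelCalculus.MKer (d + 1) (Fib d)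
  | 0 => S0 d Lc cE cVH cΛ
  | n + 1 => fun κ u =>
      ((Lc : ℝ) ^ (d + 1)) • pushSum (Lc ^ (n + 1)) Lc (Sc cE cVH cΛ n κ u) +
        (cVH * ((Lc : ℝ) ^ (n + 1)) ^ (d + 2)) • borderInc d Lc (Lc ^ (n + 1)) κ u +
        (cΛ * ((Lc : ℝ) ^ (n + 1)) ^ (2 * d + 4)) • lagrInc d Lc (Lc ^ (n + 1)) (Lc ^ (n + 2)) κ u

variable {d Lc}

/-- [folklore] The base of the recursion is the first-step stencil `S₀`. -/
@[simp] theorem Sc_zero (cE cVH cΛ : ℝ) : Sc d Lc cE cVH cΛ 0 = S0 d Lc cE cVH cΛ := rfl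

/-- [folklore] The recursion step (unfolding lemma). -/
theorem Sc_succ (cE cVH cΛ : ℝ) (n : ℕ) : Sc d Lc cE cVH cΛ (n + 1) = fun κ u =>
    ((Lc : ℝ) ^ (d + 1)) • pushSum (Lc ^ (n + 1)) Lc (Sc d Lc cE cVH cΛ n κ u) +
      (cVH * ((Lc : ℝ) ^ (n + 1)) ^ (d + 2)) • borderInc d Lc (Lc ^ (n + 1)) κ u +
      (cΛ * ((Lc : ℝ) ^ (n + 1)) ^ (2 * d + 4)) • lagrInc d Lc (Lc ^ (n + 1)) (Lc ^ (n + 2)) κ u := rfl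

/-- [folklore] **EVERY COMPOSITE STENCIL FAMILY IS A LOCAL STENCIL FAMILY** (the `loc` field of `JetData` at every composite level):
some rate `δ > 0` and constant (existential; the rate at level `n+1` is the minimum of the level-`n` rate and half the decay rate of
`KInv (Lc^{n+2})` — no uniformity in `n` claimed or needed by the road) — by induction from `locStencil_S0`, `biLoc_pushSum`,
`locStencil_borderInc`, `locStencil_lagrInc`, `locStencil_add`/`locStencil_smul`/`locStencil_mono`. -/
theorem locStencil_Sc (hLc : 1 ≤ Lc) (cE cVH cΛ : ℝ) : ∀ n : ℕ, ∃ Cs δ : ℝ, 0 < δ ∧ LocStencil (Sc d Lc cE cVH cΛ n) Cs δ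
  | 0 => locStencil_S0 hLc cE cVH cΛ
  | n + 1 => by
      obtain ⟨Cs, δ, hδ, hloc⟩ := locStencil_Sc hLc cE cVH cΛ n
      obtain ⟨CL, δL, hδL, hlocL⟩ :=
        locStencil_lagrInc (d := d) (Lc := Lc) (M := Lc ^ (n + 1)) (N' := Lc ^ (n + 2)) hLc (pow_succ Lc (n + 1))
      have hCs : 0 ≤ Cs := (hloc 0 0).nonneg (Sum.inl 0)
      have hCL : 0 ≤ CL := (hlocL 0 0).nonneg (Sum.inl 0)
      have h1 : LocStencil (fun κ u => pushSum (Lc ^ (n + 1)) Lc (Sc d Lc cE cVH cΛ n κ u))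
          (Cs * ((Lc : ℝ) ^ (d + 2)) ^ 2 * Real.exp (4 * (d + 1) * (Lc ^ (n + 1) : ℕ) * Lc * δ)) δ :=
        fun κ u => biLoc_pushSum (M := Lc ^ (n + 1)) hLc (hloc κ u) hδ.le
      have h2 := locStencil_borderInc (d := d) (Lc := Lc) (M := Lc ^ (n + 1)) hLc hδ.le
      have h1' := locStencil_mono h1 ((h1 0 0).nonneg (Sum.inl 0)) (min_le_left δ δL)
      have h2' := locStencil_mono h2 ((h2 0 0).nonneg (Sum.inl 0)) (min_le_left δ δL)
      have h3' := locStencil_mono hlocL hCL (min_le_right δ δL)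
      have hfin := locStencil_add (locStencil_add (locStencil_smul ((Lc : ℝ) ^ (d + 1)) h1')
        (locStencil_smul (cVH * ((Lc : ℝ) ^ (n + 1)) ^ (d + 2)) h2'))
        (locStencil_smul (cΛ * ((Lc : ℝ) ^ (n + 1)) ^ (2 * d + 4)) h3')
      exact ⟨_, min δ δL, lt_min hδ hδL, fun κ u => by rw [Sc_succ]; exact hfin κ u⟩

end Composite

/-! ## §4 Packaging: the composite jet data `jcOf … m : JetData d (Lc^m)` with abstract second-order families -/

section Packaging

variable {Lc : ℕ} [NeZero Lc]

/-- [folklore] **THE COMPOSITE JET DATA** (STAGING OBJECT, like `BalabanStepJets.jsBal0Of`): at composite level `m ≥ 1` the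
first-order part is the DEFINED composite stencil family `Sc … (m − 1)` and the second-order part is the given family `W m`
(bi-localised at the level-`m` coarse bonds, rate `δw m > 0`; Bałaban's composite second-order jets — transported (V-V) tables, lifted
step second jets, the inter-level cross terms — are the P4 node and ABSTRACT here), common rate the minimum.  Level `m = 0` is a dummy
member (the road `TshotOf` is read at `m ≥ 1` only; `D1Rep`/`D1Sum` quantify `1 ≤ m`).  So `OneStepKernelFamily.TshotOf Lc (jcOf …)`
is a typed one-shot kernel family and every socket lemma applies to it BY NAME. -/
def jcOf (hLc : 1 ≤ Lc) (cE cVH cΛ : ℝ)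
    (W : ℕ → Fin (d + 1) → (Fin (d + 1) → ℤ) → Fin (d + 1) → (Fin (d + 1) → ℤ) → ExpKernelCalculus.MKer (d + 1) (Fib d))
    (Cw δw : ℕ → ℝ) (hδw : ∀ m, 0 < δw m) (hW : ∀ m, VertexFamily₂ (W m) (Lc ^ m) (Cw m) (δw m)) (m : ℕ) :
    JetData d (Lc ^ m) :=
  have hS := locStencil_Sc (d := d) (Lc := Lc) hLc cE cVH cΛ (m - 1)
  have hδS : 0 < hS.choose_spec.choose := hS.choose_spec.choose_spec.1
  have hloc : LocStencil (Sc d Lc cE cVH cΛ (m - 1)) hS.choose hS.choose_spec.choose := hS.choose_spec.choose_spec.2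
  { S := Sc d Lc cE cVH cΛ (m - 1)
    W := W m
    Cs := hS.choose
    Cw := Cw m
    δ := min hS.choose_spec.choose (δw m)
    δ_pos := lt_min hδS (hδw m)
    loc := locStencil_mono hloc ((hloc 0 0).nonneg (Sum.inl 0)) (min_le_left _ _)
    loc₂ := vertexFamily₂_mono (hW m) ((hW m 0 0 0 0).nonneg (Sum.inl 0)) (min_le_right _ _) }

/-- [folklore] The first-order part of the level-`m` composite datum is `Sc … (m − 1)`. -/
@[simp] theorem jcOf_S (hLc : 1 ≤ Lc) (cE cVH cΛ : ℝ)
    (W : ℕ → Fin (d + 1) → (Fin (d + 1) → ℤ) → Fin (d + 1) → (Fin (d + 1) → ℤ) → ExpKernelCalculus.MKer (d + 1) (Fib d))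
    (Cw δw : ℕ → ℝ) (hδw : ∀ m, 0 < δw m) (hW : ∀ m, VertexFamily₂ (W m) (Lc ^ m) (Cw m) (δw m)) (m : ℕ) :
    (jcOf hLc cE cVH cΛ W Cw δw hδw hW m).S = Sc d Lc cE cVH cΛ (m - 1) := rfl

/-- [folklore] The second-order part of the level-`m` composite datum is the given `W m`. -/
@[simp] theorem jcOf_W (hLc : 1 ≤ Lc) (cE cVH cΛ : ℝ)
    (W : ℕ → Fin (d + 1) → (Fin (d + 1) → ℤ) → Fin (d + 1) → (Fin (d + 1) → ℤ) → ExpKernelCalculus.MKer (d + 1) (Fib d))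
    (Cw δw : ℕ → ℝ) (hδw : ∀ m, 0 < δw m) (hW : ∀ m, VertexFamily₂ (W m) (Lc ^ m) (Cw m) (δw m)) (m : ℕ) :
    (jcOf hLc cE cVH cΛ W Cw δw hδw hW m).W = W m := rfl

/-- [folklore] At composite level `1` the first-order part IS the first-step stencil `S₀` (the composite of one step is the step). -/
theorem jcOf_one_S (hLc : 1 ≤ Lc) (cE cVH cΛ : ℝ)
    (W : ℕ → Fin (d + 1) → (Fin (d + 1) → ℤ) → Fin (d + 1) → (Fin (d + 1) → ℤ) → ExpKernelCalculus.MKer (d + 1) (Fib d))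
    (Cw δw : ℕ → ℝ) (hδw : ∀ m, 0 < δw m) (hW : ∀ m, VertexFamily₂ (W m) (Lc ^ m) (Cw m) (δw m)) :
    (jcOf hLc cE cVH cΛ W Cw δw hδw hW 1).S = S0 d Lc cE cVH cΛ := rfl

end Packaging

/-! ## §5 The base identification `hbase : TshotOf Lc Jc 1 = TbalOf Lc Js 0` -/

section Base

variable {Lc : ℕ} [NeZero Lc]

/-- [folklore] The chain-rule vertex constructor does not see HOW the blocking factor is written (`Lc ^ 1` versus `Lc`). -/
theorem vertexOfK_congr_N (K : ExpKernelCalculus.MKer (d + 1) (Fib d)) {N N' : ℕ} (h : N = N')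
    (S : Fin (d + 1) → (Fin (d + 1) → ℤ) → ExpKernelCalculus.MKer (d + 1) (Fib d)) : vertexOfK K N S = vertexOfK K N' S := by
  subst h; rfl

/-- [folklore] **THE BASE IDENTIFICATION, ABSTRACT FORM** (the route binder `hbase` of `StepDriftWitness.d1Sum_of_stepDefect` /
an4's `secondMomentSum_of_stepRecursionUpTo_wStep`): if the level-`1` composite datum and the step-`0` datum have the same first- and
second-order parts, the one-shot kernel at `m = 1` IS the one-step kernel at `j = 0` — the one-step system IS the `1`-fold composite
(`KInvStep Lc 0 = KInv (Lc^1)`, an4's `kInvStep_zero`/`tbalOf_zero`; `vertexOfK (KInv N) N = vertexOf`, `vertexOfK_KInv`).  Pure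
bookkeeping across the cast `Lc ^ 1 = Lc`; no analysis. -/
theorem tshotOf_one_eq_tbalOf_zero (Js : ℕ → JetData 3 Lc) (Jc : ∀ m : ℕ, JetData 3 (Lc ^ m)) (hS : (Jc 1).S = (Js 0).S)
    (hW : (Jc 1).W = (Js 0).W) : TshotOf Lc Jc 1 = TbalOf Lc Js 0 := by
  rw [tbalOf_zero]
  show TOf (N := Lc ^ 1) (Jc 1) = _
  unfold TOf
  have hv : vertexOf (N := Lc ^ 1) (Jc 1).S = vertexOfK (KInv (N := Lc ^ 1)) (Lc ^ 1) (Jc 1).S := by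
    funext μ y
    exact (vertexOfK_KInv (N := Lc ^ 1) (Jc 1).S μ y).symm
  rw [hv, vertexOfK_congr_N (KInv (N := Lc ^ 1)) (pow_one Lc), hS, hW]

/-- [folklore] **THE BASE IDENTIFICATION FOR THE PACKAGED COMPOSITE JETS**: for ANY step jet data `Js` whose `j = 0` member has
first-order part `S₀ = BalabanStepJets.S0 3 Lc cE cVH cΛ` and second-order part `W 1` (e.g. `Js 0 = BalabanStepJets.jsBal0Of hLc cE
cVH cΛ (W 1) …`), `TshotOf Lc (jcOf hLc cE cVH cΛ W …) 1 = TbalOf Lc Js 0`.  This DISCHARGES the binder `hbase` of the (D1) census for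
the pair (Bałaban's step jets, the composite jets of this file) once both carry the same `j = 0` / `m = 1` second-order family — the
one place where the two P4 deliveries must agree by definition. -/
theorem tshotOf_jcOf_one (hLc : 1 ≤ Lc) (cE cVH cΛ : ℝ)
    (W : ℕ → Fin 4 → (Fin 4 → ℤ) → Fin 4 → (Fin 4 → ℤ) → ExpKernelCalculus.MKer 4 (Fib 3))
    (Cw δw : ℕ → ℝ) (hδw : ∀ m, 0 < δw m) (hW : ∀ m, VertexFamily₂ (W m) (Lc ^ m) (Cw m) (δw m))
    (Js : ℕ → JetData 3 Lc) (h0S : (Js 0).S = S0 3 Lc cE cVH cΛ) (h0W : (Js 0).W = W 1) :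
    TshotOf Lc (jcOf hLc cE cVH cΛ W Cw δw hδw hW) 1 = TbalOf Lc Js 0 :=
  tshotOf_one_eq_tbalOf_zero Js _ (by rw [jcOf_one_S, h0S]) (by rw [jcOf_W, h0W])

/-- [folklore] The instance with `Js 0 := jsBal0Of hLc cE cVH cΛ (W 1) (Cw 1) (δw 1) (hδw 1) h1` (any members `j ≥ 1`). -/
theorem tshotOf_jcOf_one_jsBal0Of (hLc : 1 ≤ Lc) (cE cVH cΛ : ℝ)
    (W : ℕ → Fin 4 → (Fin 4 → ℤ) → Fin 4 → (Fin 4 → ℤ) → ExpKernelCalculus.MKer 4 (Fib 3))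
    (Cw δw : ℕ → ℝ) (hδw : ∀ m, 0 < δw m) (hW : ∀ m, VertexFamily₂ (W m) (Lc ^ m) (Cw m) (δw m))
    (h1 : VertexFamily₂ (W 1) Lc (Cw 1) (δw 1)) (Js : ℕ → JetData 3 Lc)
    (h0 : Js 0 = BalabanStepJets.jsBal0Of hLc cE cVH cΛ (W 1) (Cw 1) (δw 1) (hδw 1) h1) :
    TshotOf Lc (jcOf hLc cE cVH cΛ W Cw δw hδw hW) 1 = TbalOf Lc Js 0 :=
  tshotOf_jcOf_one hLc cE cVH cΛ W Cw δw hδw hW Js (by rw [h0]; rfl) (by rw [h0]; rfl)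

omit [NeZero Lc] in
/-- [folklore] The hypothesis `h1` of the previous lemma is supplied by `hW 1` across the cast `Lc ^ 1 = Lc`. -/
theorem vertexFamily₂_W_one
    (W : ℕ → Fin (d + 1) → (Fin (d + 1) → ℤ) → Fin (d + 1) → (Fin (d + 1) → ℤ) → ExpKernelCalculus.MKer (d + 1) (Fib d))
    (Cw δw : ℕ → ℝ) (hW : ∀ m, VertexFamily₂ (W m) (Lc ^ m) (Cw m) (δw m)) : VertexFamily₂ (W 1) Lc (Cw 1) (δw 1) := by
  have h := hW 1
  rwa [pow_one] at h

end Base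

/-! ## §6 The stripping convention is preserved: every composite stencil family is antisymmetric on the packed fibre -/

section Antisymm

variable {Lc : ℕ} [NeZero Lc]

omit [NeZero Lc] in
/-- [folklore] The push treats the two legs alike, so it preserves antisymmetry. -/
theorem pushSum_antisymm (M L : ℕ) {K : ExpKernelCalculus.MKer (d + 1) (Fib d)} (hK : ∀ x z a b, K z x b a = -K x z a b)
    (x z : Fin (d + 1) → ℤ) (a b : Fib d) : pushSum M L K z x b a = -pushSum M L K x z a b := by
  simp only [pushSum]
  rw [Finset.sum_comm, mul_comm (pushInd M L b z) (pushInd M L a x), ← mul_neg, ← Finset.sum_neg_distrib]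
  congr 1
  refine Finset.sum_congr rfl fun i _ => ?_
  rw [← Finset.sum_neg_distrib]
  exact Finset.sum_congr rfl fun i' _ => hK _ _ _ _

omit [NeZero Lc] in
/-- [folklore] The averaging lift treats the two legs alike, so it preserves antisymmetry. -/
theorem avgLift_antisymm (M : ℕ) {G : ExpKernelCalculus.MKer (d + 1) (Fib d)} (hG : ∀ x z a b, G z x b a = -G x z a b)
    (x z : Fin (d + 1) → ℤ) (a b : Fib d) : avgLift M G z x b a = -avgLift M G x z a b := by
  simp only [avgLift]
  rw [Finset.sum_comm, ← Finset.sum_neg_distrib]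
  refine Finset.sum_congr rfl fun i _ => ?_
  rw [← Finset.sum_neg_distrib]
  refine Finset.sum_congr rfl fun i' _ => ?_
  rw [mul_comm (legW d M b) (legW d M a)]
  by_cases h : Torus.proj M (x - InterLevelTransport.legOff M a i) = 0 ∧ Torus.proj M (z - InterLevelTransport.legOff M b i') = 0
  · rw [if_pos h, if_pos (And.intro h.2 h.1), hG, mul_neg]
  · have h' : ¬(Torus.proj M (z - InterLevelTransport.legOff M b i') = 0 ∧
        Torus.proj M (x - InterLevelTransport.legOff M a i) = 0) := fun hh => h ⟨hh.2, hh.1⟩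
    rw [if_neg h, if_neg h']
    simp

omit [NeZero Lc] in
/-- [folklore] an1's field–multiplier kernel through the block-sign adapter is antisymmetric (as in `BalabanStepJets.S0_antisymm`). -/
theorem mfNeg_vhS_antisymm (Lc : ℕ) (κ : Fin (d + 1)) (u x z : Fin (d + 1) → ℤ) (a b : Fib d) :
    mfNeg (vhS d Lc κ u) z x b a = -mfNeg (vhS d Lc κ u) x z a b :=
  StepJetData.mfNeg_antisymm (K := vhS d Lc κ u) (fun x z a b => AveragingHessianKernels.vhS_symm Lc κ u x z a b)
    (fun _ _ _ _ => rfl) (fun _ _ _ _ => rfl) x z a b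

omit [NeZero Lc] in
/-- [folklore] The border increment is antisymmetric. -/
theorem borderInc_antisymm (Lc M : ℕ) (κ : Fin (d + 1)) (u x z : Fin (d + 1) → ℤ) (a b : Fib d) :
    borderInc d Lc M κ u z x b a = -borderInc d Lc M κ u x z a b := by
  simp only [borderInc]
  rw [← Finset.sum_neg_distrib]
  exact Finset.sum_congr rfl fun s _ => avgLift_antisymm M (fun x z a b => mfNeg_vhS_antisymm Lc κ _ x z a b) x z a b

omit [NeZero Lc] in
/-- [folklore] The Lagrange increment is antisymmetric (an1's `hessFF_antisymm` through the lift and the superposition). -/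
theorem lagrInc_antisymm (Lc M N' : ℕ) [NeZero N'] (κ : Fin (d + 1)) (u x z : Fin (d + 1) → ℤ) (a b : Fib d) :
    lagrInc d Lc M N' κ u z x b a = -lagrInc d Lc M N' κ u x z a b := by
  simp only [lagrInc, SLam, neg_neg]
  rw [← Finset.sum_neg_distrib]
  exact Finset.sum_congr rfl fun μ _ => by
    rw [BalabanStepJets.cwsum_antisymm _ (fun y x z a b =>
      avgLift_antisymm M (fun x z a b => AveragingHessianKernels.hessFF_antisymm Lc μ y x z a b) x z a b) x z a b, neg_neg]

/-- [folklore] **EVERY COMPOSITE STENCIL FAMILY IS ANTISYMMETRIC ON THE PACKED FIBRE** (the stripping convention of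
`Beta/StepJetData` §5 survives the level recursion): `Sc … n κ u z x b a = −Sc … n κ u x z a b` — by induction from
`BalabanStepJets.S0_antisymm`, `pushSum_antisymm`, `borderInc_antisymm`, `lagrInc_antisymm`. -/
theorem Sc_antisymm (cE cVH cΛ : ℝ) : ∀ (n : ℕ) (κ : Fin (d + 1)) (u x z : Fin (d + 1) → ℤ) (a b : Fib d),
    Sc d Lc cE cVH cΛ n κ u z x b a = -Sc d Lc cE cVH cΛ n κ u x z a b
  | 0, κ, u, x, z, a, b => BalabanStepJets.S0_antisymm cE cVH cΛ κ u x z a b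
  | n + 1, κ, u, x, z, a, b => by
      have h1 := pushSum_antisymm (Lc ^ (n + 1)) Lc (fun x z a b => Sc_antisymm cE cVH cΛ n κ u x z a b) x z a b
      have h2 := borderInc_antisymm (d := d) Lc (Lc ^ (n + 1)) κ u x z a b
      have h3 := lagrInc_antisymm (d := d) Lc (Lc ^ (n + 1)) (Lc ^ (n + 2)) κ u x z a b
      simp only [Sc_succ, Pi.add_apply, Pi.smul_apply, smul_eq_mul]
      rw [h1, h2, h3]
      ring

end Antisymm

/-! ## §6b Block-translation covariance: `Sc n κ (u + Lc^{n+1}•t) = shiftK (−Lc^{n+1}•t) (Sc n κ u)` (the `covS` socket) -/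

section Translate

variable {Lc : ℕ} [NeZero Lc]

/-- [folklore] The push points translate with the new coarse lattice: `pushPt M L a (x + (M·L)•t) i = pushPt M L a x i + (M·L)•t`. -/
theorem pushPt_add (M L : ℕ) [NeZero (M * L)] (a : Fib d) (x t : Fin (d + 1) → ℤ) (i : (Fin (d + 1) → ℕ) × ℕ) :
    pushPt M L a (x + ((M * L : ℕ) : ℤ) • t) i = pushPt M L a x i + ((M * L : ℕ) : ℤ) • t := by
  rcases a with κ | μ
  · rfl
  · simp only [pushPt]
    rw [quo_add_zsmul, legPt_add, smul_add]
    congr 1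
    rw [smul_smul, Nat.cast_mul]

/-- [folklore] The support indicator of the push is invariant under the new coarse lattice. -/
theorem pushInd_add (M L : ℕ) (a : Fib d) (x t : Fin (d + 1) → ℤ) :
    pushInd M L a (x + ((M * L : ℕ) : ℤ) • t) = pushInd M L a x := by
  rcases a with κ | μ
  · rfl
  · simp only [pushInd, proj_add_zsmul]

/-- [folklore] **THE PUSH COMMUTES WITH TRANSLATIONS BY THE NEW COARSE LATTICE** `(M·L)•ℤ^{d+1}`. -/
theorem pushSum_translate (M L : ℕ) [NeZero (M * L)] (K : ExpKernelCalculus.MKer (d + 1) (Fib d)) (t : Fin (d + 1) → ℤ) :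
    pushSum M L (shiftK (-(((M * L : ℕ) : ℤ) • t)) K) = shiftK (-(((M * L : ℕ) : ℤ) • t)) (pushSum M L K) := by
  have e : -(((M * L : ℕ) : ℤ) • t) = ((M * L : ℕ) : ℤ) • (-t) := (smul_neg _ _).symm
  funext x w a b
  simp only [shiftK, pushSum, e, pushInd_add, pushPt_add]

omit [NeZero Lc] in
/-- [folklore] **BLOCK-TRANSLATION COVARIANCE OF THE BORDER INCREMENT** under the new coarse lattice `(M·Lc)•ℤ^{d+1}`
(`quo_add_zsmul`, an1's `vhS_translate`, `mfNeg_shiftK`, `avgLift_shiftK`). -/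
theorem borderInc_translate (M : ℕ) [NeZero M] (hLc : 1 ≤ Lc) (κ : Fin (d + 1)) (u t : Fin (d + 1) → ℤ) :
    borderInc d Lc M κ (u + ((M * Lc : ℕ) : ℤ) • t) = shiftK (-(((M * Lc : ℕ) : ℤ) • t)) (borderInc d Lc M κ u) := by
  have e : (M : ℤ) • -((Lc : ℤ) • t) = -(((M * Lc : ℕ) : ℤ) • t) := by rw [smul_neg, smul_smul, Nat.cast_mul]
  funext x w a b
  simp only [borderInc, shiftK]
  refine Finset.sum_congr rfl fun s _ => ?_
  have hq : quo M (u + ((M * Lc : ℕ) : ℤ) • t - bshift d κ s) = quo M (u - bshift d κ s) + (Lc : ℤ) • t := by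
    rw [show u + ((M * Lc : ℕ) : ℤ) • t - bshift d κ s = (u - bshift d κ s) + (M : ℤ) • ((Lc : ℤ) • t) by
      rw [smul_smul, ← Nat.cast_mul]; abel, quo_add_zsmul]
  rw [hq, vhS_translate hLc, mfNeg_shiftK, avgLift_shiftK, e]
  rfl

omit [NeZero Lc] in
/-- [folklore] **BLOCK-TRANSLATION COVARIANCE OF THE LAGRANGE INCREMENT** under `N′•ℤ^{d+1}`, `N′ = M·Lc` (`SLam_translate` fed with
`lamCoeffOf_translate` (`shiftK_KInv` at blocking `N′`) and `hessFF_translate` + `avgLift_shiftK`). -/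
theorem lagrInc_translate (M N' : ℕ) [NeZero M] [NeZero N'] (hN : N' = M * Lc) (κ : Fin (d + 1)) (u t : Fin (d + 1) → ℤ) :
    lagrInc d Lc M N' κ (u + (N' : ℤ) • t) = shiftK (-((N' : ℤ) • t)) (lagrInc d Lc M N' κ u) := by
  unfold lagrInc
  refine SLam_translate (N := N') ?_ ?_ κ u t
  · intro μ y κ'' u' t'
    exact lamCoeffOf_translate (fun s => shiftK_KInv (N := N') (d := d) s) μ y κ'' u' t'
  · intro μ y t'
    show avgLift M (hessFF Lc μ (y + t')) = shiftK (-((N' : ℤ) • t')) (avgLift M (hessFF Lc μ y))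
    rw [hessFF_translate, avgLift_shiftK]
    congr 1
    rw [smul_neg, smul_smul, hN, Nat.cast_mul]

/-- [folklore] **BLOCK-TRANSLATION COVARIANCE OF THE COMPOSITE STENCIL FAMILIES** — the `covS` socket of
`OneStepKernelFamily.vertexOfK_translate` / `OneStepResolventKernel.blockCovariant_KInv` at blocking `Lc^{n+1}`:
`Sc n κ (u + Lc^{n+1}•t) = shiftK (−Lc^{n+1}•t) (Sc n κ u)` — by induction from `BalabanStepJets.S0_translate`, `pushSum_translate`,
`borderInc_translate`, `lagrInc_translate`.  (Covariance under the COARSE lattice of the level only, as for `S₀`; nothing finer is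
claimed or needed.) -/
theorem Sc_translate (hLc : 1 ≤ Lc) (cE cVH cΛ : ℝ) : ∀ (n : ℕ) (κ : Fin (d + 1)) (u t : Fin (d + 1) → ℤ),
    Sc d Lc cE cVH cΛ n κ (u + (((Lc ^ (n + 1) : ℕ) : ℤ)) • t) = shiftK (-((((Lc ^ (n + 1) : ℕ) : ℤ)) • t)) (Sc d Lc cE cVH cΛ n κ u)
  | 0, κ, u, t => by
    rw [Sc_zero, show ((Lc ^ (0 + 1) : ℕ) : ℤ) = (Lc : ℤ) by rw [zero_add, pow_one]]
    exact S0_translate hLc cE cVH cΛ κ u t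
  | n + 1, κ, u, t => by
    have eN : Lc ^ (n + 1 + 1) = Lc ^ (n + 1) * Lc := pow_succ Lc (n + 1)
    have ea : ((Lc ^ (n + 1) : ℕ) : ℤ) • ((Lc : ℤ) • t) = ((Lc ^ (n + 1 + 1) : ℕ) : ℤ) • t := by
      rw [smul_smul, eN, Nat.cast_mul]
    have IH := Sc_translate hLc cE cVH cΛ n κ u ((Lc : ℤ) • t)
    rw [ea] at IH
    have h1 : pushSum (Lc ^ (n + 1)) Lc (Sc d Lc cE cVH cΛ n κ (u + ((Lc ^ (n + 1 + 1) : ℕ) : ℤ) • t))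
        = shiftK (-(((Lc ^ (n + 1 + 1) : ℕ) : ℤ) • t)) (pushSum (Lc ^ (n + 1)) Lc (Sc d Lc cE cVH cΛ n κ u)) := by
      have hp := pushSum_translate (Lc ^ (n + 1)) Lc (Sc d Lc cE cVH cΛ n κ u) t
      rw [← eN] at hp
      rw [IH, hp]
    have h2 : borderInc d Lc (Lc ^ (n + 1)) κ (u + ((Lc ^ (n + 1 + 1) : ℕ) : ℤ) • t)
        = shiftK (-(((Lc ^ (n + 1 + 1) : ℕ) : ℤ) • t)) (borderInc d Lc (Lc ^ (n + 1)) κ u) := by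
      have hb := borderInc_translate (Lc ^ (n + 1)) hLc κ u t
      rw [← eN] at hb
      exact hb
    have h3 := lagrInc_translate (Lc := Lc) (d := d) (Lc ^ (n + 1)) (Lc ^ (n + 1 + 1)) eN κ u t
    funext x w a b
    rw [Sc_succ]
    simp only [Pi.add_apply, Pi.smul_apply, smul_eq_mul]
    rw [h1, h2, h3]
    rfl

end Translate

/-! ## §7 (K1b′) AT THE VERTEX LEVEL: the one-shot chain-rule vertex transports itself from level to level -/

section Transport

/-- [folklore] A block-contour sum of a summable 1-form is summable on the coarse lattice. -/
theorem summable_contourSum (M : ℕ) [NeZero M] {A : Form1 (d + 1) ℝ} (hA : ∀ κ, Summable (A κ)) (κ : Fin (d + 1)) :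
    Summable (contourSum M A κ) := by
  unfold contourSum
  refine summable_sum fun b _ => summable_sum fun s _ => ?_
  have hi : Function.Injective fun y : Fin (d + 1) → ℤ => (M : ℤ) • y + toSite b + (s : ℤ) • unitVec κ := by
    intro y y' h
    have h1 : (M : ℤ) • y = (M : ℤ) • y' := by
      have := congrArg (fun v => v - toSite b - (s : ℤ) • unitVec κ) h
      simpa using this
    have h2 := congrArg (quo M) h1
    simpa only [quo_zsmul] using h2
  exact (hA κ).comp_injective hi

/-- [folklore] `|Σ' H·T| ≤ C_H · Σ' |T|` for bounded `H` and summable `T`. -/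
theorem abs_tsum_mul_le {H T : (Fin (d + 1) → ℤ) → ℝ} {CH : ℝ} (hH : ∀ u, |H u| ≤ CH) (hT : Summable T) :
    |∑' u, H u * T u| ≤ CH * ∑' u, |T u| := by
  have hs : Summable fun u => H u * T u := summable_mul_of_bdd hH hT
  calc |∑' u, H u * T u| ≤ ∑' u, |H u * T u| := by
        have h := norm_tsum_le_tsum_norm hs.norm
        simpa only [Real.norm_eq_abs] using h
    _ ≤ ∑' u, CH * |T u| :=
        Summable.tsum_le_tsum (fun u => by rw [abs_mul]; exact mul_le_mul_of_nonneg_right (hH u) (abs_nonneg _)) hs.abs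
          (hT.abs.mul_left CH)
    _ = CH * ∑' u, |T u| := tsum_mul_left

variable (Lc : ℕ) [NeZero Lc]

omit [NeZero Lc] in
/-- [folklore] **THE (K1b′) RESPONSE FAMILY** of the passage from blocking `M` to blocking `N′ = M·L` (coarse `M`-lattice
coordinates): the response of the level-`M` bond variable `(l″, w′)` to the level-`N′` bond variable `(μ, z)` IS the `M`-block-contour
sum of the level-`N′` minimiser column — `R(l″, w′ ← μ, z) := (𝒬_M ℋ_{N′}(·; μ, z))(l″, w′)` (an5's `ResolventComposition.Hcol`,
`AffineAveraging.contourSum`).  For `M = Lc^j`, `N′ = Lc^{j+1}` it is `(Lc^j)^{d+2} ·` the `(inl, inr)` entry of the decimated step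
resolvent `KInvStep Lc j` (`respStep_eq`), i.e. at `d = 3` EXACTLY an4's `wStep Lc j` weight read at the relative position (`respStep_eq_wStep`, §8; UNITS in
the module docstring: the bond-unit factor `Lc^{d+1}` of `StepDriftWitness.respBond` is supplied by the jets' own rescaling, §3). -/
def respStep (M N' : ℕ) [NeZero N'] (μ : Fin (d + 1)) (z : Fin (d + 1) → ℤ) (l'' : Fin (d + 1)) (w' : Fin (d + 1) → ℤ) : ℝ :=
  contourSum M (Hcol (N := N') (d := d) μ z) l'' w'

/-- [folklore] PIN: the (K1b′) response family between consecutive composite levels is `(Lc^j)^{d+2} · KInvStep Lc j w′ (Lc•z) (inl l″) (inr μ)`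
(an5's `KInvStep_inl_inr`). -/
theorem respStep_eq (j : ℕ) (μ : Fin (d + 1)) (z : Fin (d + 1) → ℤ) (l'' : Fin (d + 1)) (w' : Fin (d + 1) → ℤ) :
    respStep (d := d) (Lc ^ j) (Lc ^ (j + 1)) μ z l'' w'
      = (((Lc ^ j : ℕ) : ℝ) ^ (d + 2)) * KInvStep (d := d) Lc j w' (((Lc : ℕ) : ℤ) • z) (Sum.inl l'') (Sum.inr μ) := by
  have hC : (((Lc ^ j : ℕ) : ℝ) ^ (d + 2)) ≠ 0 :=
    pow_ne_zero _ (by exact_mod_cast (pow_pos (Nat.pos_of_ne_zero (NeZero.ne Lc)) j).ne')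
  rw [KInvStep_inl_inr, ← mul_assoc, mul_inv_cancel₀ hC, one_mul]
  rfl

omit [NeZero Lc] in
/-- [folklore] The response family is summable in the level-`M` bond position. -/
theorem summable_respStep (M N' : ℕ) [NeZero M] [NeZero N'] (μ : Fin (d + 1)) (z : Fin (d + 1) → ℤ) (l'' : Fin (d + 1)) :
    Summable (respStep (d := d) M N' μ z l'') :=
  summable_contourSum M (fun κ => (Hcol_bdd_summable (N := N') (d := d)).choose_spec.2.2 μ z κ) l''

omit [NeZero Lc] in
/-- [folklore] Every slice `u ↦ S κ u x₁ x₂ a b` of a local stencil family is summable. -/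
theorem summable_slice_of_locStencil {S : Fin (d + 1) → (Fin (d + 1) → ℤ) → ExpKernelCalculus.MKer (d + 1) (Fib d)} {Cs δ : ℝ}
    (hS : LocStencil S Cs δ) (hδ : 0 < δ) (κ : Fin (d + 1)) (x₁ x₂ : Fin (d + 1) → ℤ) (a b : Fib d) :
    Summable fun u => S κ u x₁ x₂ a b := by
  have hCs : 0 ≤ Cs := (hS 0 0).nonneg (Sum.inl 0)
  refine Summable.of_norm_bounded ((ExpKernelCalculus.summable_exp_shift hδ x₁).mul_left Cs) (fun u => ?_)
  rw [Real.norm_eq_abs]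
  refine (hS κ u x₁ x₂ a b).trans (mul_le_mul_of_nonneg_left (Real.exp_le_exp.2 ?_) hCs)
  nlinarith [l1_nonneg (x₂ - u), l1_nonneg (x₁ - u)]

omit [NeZero Lc] in
/-- [folklore] **(K1b′) AT THE VERTEX LEVEL, GENERAL FORM**: `vertexOf (N := N′) S = transportV M (respStep M N′) (vertexOf (N := M) S)` for
every stencil family with SUMMABLE slices (the only property of `S` the argument uses; `vertexOf_eq_transportV` is the local-stencil
instance, `vertex2Of_eq_transportW` (§9) applies it in each slot of a bi-stencil family).  PROOF: an5's `wH_reproduction` under the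
stencil sum and one Fubini interchange (`KernelWard.tsum_comm_of_prodBound`). -/
theorem vertexOf_eq_transportV_of_summable {N' M L : ℕ} [NeZero N'] [NeZero M] [NeZero L] (hN : N' = M * L)
    {S : Fin (d + 1) → (Fin (d + 1) → ℤ) → ExpKernelCalculus.MKer (d + 1) (Fib d)}
    (hSum : ∀ (κ : Fin (d + 1)) (x₁ x₂ : Fin (d + 1) → ℤ) (a b : Fib d), Summable fun u => S κ u x₁ x₂ a b)
    (μ : Fin (d + 1)) (z : Fin (d + 1) → ℤ) :
    vertexOf (N := N') S μ z = transportV M (respStep (d := d) M N') (vertexOf (N := M) S) μ z := by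
  obtain ⟨CH, hCH, hHb, _⟩ := Hcol_bdd_summable (N := M) (d := d)
  funext x₁ x₂ a b
  -- notation
  set R : Fin (d + 1) → (Fin (d + 1) → ℤ) → ℝ := fun l'' w' => respStep (d := d) M N' μ z l'' w' with hR
  set H : Fin (d + 1) → Fin (d + 1) → (Fin (d + 1) → ℤ) → (Fin (d + 1) → ℤ) → ℝ :=
    fun κ l'' u w' => wH (N := M) (d := d) κ l'' (u - (M : ℤ) • w') with hH
  set T : Fin (d + 1) → (Fin (d + 1) → ℤ) → ℝ := fun κ u => S κ u x₁ x₂ a b with hT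
  have hRs : ∀ l'', Summable (R l'') := fun l'' => summable_respStep (d := d) M N' μ z l''
  have hHle : ∀ κ l'' u w', |H κ l'' u w'| ≤ CH := fun κ l'' u w' => by
    have h := hHb l'' w' κ u
    rwa [Hcol_apply] at h
  have hTs : ∀ κ, Summable (T κ) := fun κ => hSum κ x₁ x₂ a b
  -- the slice `X κ l'' w' := Σ'_u H · T` and its bound
  set X : Fin (d + 1) → Fin (d + 1) → (Fin (d + 1) → ℤ) → ℝ := fun κ l'' w' => ∑' u, H κ l'' u w' * T κ u with hX
  have hXle : ∀ κ l'' w', |X κ l'' w'| ≤ CH * ∑' u, |T κ u| := fun κ l'' w' =>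
    abs_tsum_mul_le (fun u => hHle κ l'' u w') (hTs κ)
  -- LEFT: unfold and reproduce the level-`N'` columns
  have lhs : vertexOf (N := N') S μ z x₁ x₂ a b = ∑ κ, ∑' u, (∑' w', ∑ l'', R l'' w' * H κ l'' u w') * T κ u := by
    show (∑ κ, ∑' u, wH (N := N') (d := d) κ μ (u - (N' : ℤ) • z) * S κ u x₁ x₂ a b) = _
    refine Finset.sum_congr rfl fun κ _ => tsum_congr fun u => ?_
    rw [wH_reproduction hN μ z κ u]
    rfl
  -- per `κ`: Fubini
  have mid : ∀ κ, (∑' u, (∑' w', ∑ l'', R l'' w' * H κ l'' u w') * T κ u) = ∑' w', ∑ l'', R l'' w' * X κ l'' w' := by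
    intro κ
    have hPB : ProdBound (fun u w' => (∑ l'', R l'' w' * H κ l'' u w') * T κ u) := by
      refine ⟨fun u => |T κ u|, fun w' => CH * ∑ l'', |R l'' w'|, (hTs κ).abs,
        (summable_sum fun l'' _ => (hRs l'').abs).mul_left CH, fun u => abs_nonneg _,
        fun w' => mul_nonneg hCH (Finset.sum_nonneg fun l'' _ => abs_nonneg _), fun u w' => ?_⟩
      rw [abs_mul, mul_comm]
      refine mul_le_mul_of_nonneg_left ?_ (abs_nonneg _)
      calc |∑ l'', R l'' w' * H κ l'' u w'| ≤ ∑ l'', |R l'' w' * H κ l'' u w'| := Finset.abs_sum_le_sum_abs _ _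
        _ ≤ ∑ l'', |R l'' w'| * CH := Finset.sum_le_sum fun l'' _ => by
            rw [abs_mul]; exact mul_le_mul_of_nonneg_left (hHle κ l'' u w') (abs_nonneg _)
        _ = CH * ∑ l'', |R l'' w'| := by rw [Finset.mul_sum]; exact Finset.sum_congr rfl fun l'' _ => mul_comm _ _
    calc (∑' u, (∑' w', ∑ l'', R l'' w' * H κ l'' u w') * T κ u)
        = ∑' u, ∑' w', (∑ l'', R l'' w' * H κ l'' u w') * T κ u := tsum_congr fun u => tsum_mul_right.symm
      _ = ∑' w', ∑' u, (∑ l'', R l'' w' * H κ l'' u w') * T κ u := tsum_comm_of_prodBound hPB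
      _ = ∑' w', ∑ l'', R l'' w' * X κ l'' w' := tsum_congr fun w' => by
          have hsl : ∀ l'' ∈ (Finset.univ : Finset (Fin (d + 1))),
              Summable fun u => R l'' w' * (H κ l'' u w' * T κ u) := fun l'' _ =>
            (summable_mul_of_bdd (fun u => hHle κ l'' u w') (hTs κ)).mul_left (R l'' w')
          calc (∑' u, (∑ l'', R l'' w' * H κ l'' u w') * T κ u)
              = ∑' u, ∑ l'', R l'' w' * (H κ l'' u w' * T κ u) := tsum_congr fun u => by
                  rw [Finset.sum_mul]; exact Finset.sum_congr rfl fun l'' _ => mul_assoc _ _ _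
            _ = ∑ l'', ∑' u, R l'' w' * (H κ l'' u w' * T κ u) := Summable.tsum_finsetSum hsl
            _ = ∑ l'', R l'' w' * X κ l'' w' := Finset.sum_congr rfl fun l'' _ => tsum_mul_left
  -- RIGHT: unfold the transport
  have rhs : transportV M (respStep (d := d) M N') (vertexOf (N := M) S) μ z x₁ x₂ a b
      = ∑ l'', ∑' w', R l'' w' * ∑ κ, X κ l'' w' := by
    show (∑ l'', cwsum M (fun w' => respStep (d := d) M N' μ z l'' w') (vertexOf (N := M) S l'') x₁ x₂ a b) = _
    refine Finset.sum_congr rfl fun l'' _ => ?_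
    rw [cwsum_apply]
    rfl
  -- regroup the finite sums across the coarse series
  have hsw : ∀ κ l'', Summable fun w' => R l'' w' * X κ l'' w' := fun κ l'' =>
    summable_mul_of_bdd' (hRs l'') (fun w' => hXle κ l'' w')
  rw [lhs, rhs, Finset.sum_congr rfl fun κ _ => mid κ]
  calc (∑ κ, ∑' w', ∑ l'', R l'' w' * X κ l'' w')
      = ∑' w', ∑ κ, ∑ l'', R l'' w' * X κ l'' w' :=
        (Summable.tsum_finsetSum (fun κ _ => summable_sum fun l'' _ => hsw κ l'')).symm
    _ = ∑' w', ∑ l'', R l'' w' * ∑ κ, X κ l'' w' := tsum_congr fun w' => by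
        rw [Finset.sum_comm]; exact Finset.sum_congr rfl fun l'' _ => by rw [Finset.mul_sum]
    _ = ∑ l'', ∑' w', R l'' w' * ∑ κ, X κ l'' w' := Summable.tsum_finsetSum (fun l'' _ => by
        have h := summable_sum (s := (Finset.univ : Finset (Fin (d + 1)))) fun κ _ => hsw κ l''
        refine (h.congr fun w' => ?_)
        rw [Finset.mul_sum])

omit [NeZero Lc] in
/-- [folklore] **(K1b′) AT THE VERTEX LEVEL — THE ONE-SHOT CHAIN-RULE VERTEX TRANSPORTS ITSELF.**  For EVERY local stencil family
`S` and every commensurate pair of blockings `N′ = M·L`: the one-shot chain-rule vertex at blocking `N′` IS the transport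
(`InterLevelTransport.transportV`, an2) of the one-shot chain-rule vertex at blocking `M` by the (K1b′) response family `respStep M N′`:
`vertexOf (N := N′) S μ z = Σ_{l″} Σ'_{w′} R(l″, w′ ← μ, z) • vertexOf (N := M) S l″ w′`.  PROOF: an5's reproduction of the
level-`N′` minimiser columns by the level-`M` columns (`ResolventComposition.wH_reproduction`, the content of (K1b′) = `k1b'`) under the
stencil sum, and one Fubini interchange justified by the product majorant (summable response × bounded minimiser × summable stencil
slice; `KernelWard.tsum_comm_of_prodBound`).  CONSEQUENCE (module docstring, (D-μ)): the first-order part of the composite one-shot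
kernel at level `m+1` is obtained from the level-`m` one WITHOUT any transport inside the jets — the recursion `Sc` is at STENCIL level. -/
theorem vertexOf_eq_transportV {N' M L : ℕ} [NeZero N'] [NeZero M] [NeZero L] (hN : N' = M * L)
    {S : Fin (d + 1) → (Fin (d + 1) → ℤ) → ExpKernelCalculus.MKer (d + 1) (Fib d)} {Cs δ : ℝ} (hS : LocStencil S Cs δ)
    (hδ : 0 < δ) (μ : Fin (d + 1)) (z : Fin (d + 1) → ℤ) :
    vertexOf (N := N') S μ z = transportV M (respStep (d := d) M N') (vertexOf (N := M) S) μ z :=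
  vertexOf_eq_transportV_of_summable hN (summable_slice_of_locStencil hS hδ) μ z

/-- [folklore] **THE CONSECUTIVE-LEVEL INSTANCE** (`M = Lc^j`, `N′ = Lc^{j+1}`): the level-`(j+1)` one-shot chain-rule vertex of
any local stencil family is the transport of its level-`j` one by `respStep (Lc^j) (Lc^{j+1})` (= `(Lc^j)^{d+2} · KInvStep Lc j`,
`respStep_eq`). -/
theorem vertexOf_pow_succ {S : Fin (d + 1) → (Fin (d + 1) → ℤ) → ExpKernelCalculus.MKer (d + 1) (Fib d)} {Cs δ : ℝ}
    (hS : LocStencil S Cs δ) (hδ : 0 < δ) (j : ℕ) (μ : Fin (d + 1)) (z : Fin (d + 1) → ℤ) :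
    vertexOf (N := Lc ^ (j + 1)) S μ z
      = transportV (Lc ^ j) (respStep (d := d) (Lc ^ j) (Lc ^ (j + 1))) (vertexOf (N := Lc ^ j) S) μ z :=
  vertexOf_eq_transportV (d := d) (pow_succ Lc j) hS hδ μ z

end Transport

/-! ## §9 The one-shot SECOND-ORDER vertex of a fine bi-stencil family and its (K1b′ ⊗ K1b′) self-transport -/

section SecondOrder

/-- [folklore] **LOCAL FINE BI-STENCIL FAMILY** `S₂ κ u κ′ u′` (a kernel per ORDERED PAIR of fine bonds — the shape of a fine
second-order table such as an3's `WilsonVertex2Kron.wilsonVertex₂` per bond pair): bi-localised at the first bond `u`, with a constant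
decaying in the separation of the two bonds, `|S₂ κ u κ′ u′ x y a b| ≤ C e^{−δ|u′−u|} e^{−δ(|x−u| + |y−u|)}`. -/
def LocStencil₂ (S₂ : Fin (d + 1) → (Fin (d + 1) → ℤ) → Fin (d + 1) → (Fin (d + 1) → ℤ) → ExpKernelCalculus.MKer (d + 1) (Fib d))
    (C δ : ℝ) : Prop :=
  ∀ κ u κ' u', BiLoc (S₂ κ u κ' u') u u (C * Real.exp (-δ * l1 (u' - u))) δ

/-- [folklore] **THE ONE-SHOT SECOND-ORDER VERTEX** of a fine bi-stencil family at blocking `N`: both fine bond slots read through the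
minimiser columns of the `N`-fold packed resolvent — `vertex2Of N S₂ μ z ν z′ = Σ_{κ,κ′} Σ'_{u,u′} ℋ_N(κ,u;μ,z) ℋ_N(κ′,u′;ν,z′) • S₂ κ u κ′ u′`,
written as the chain-rule vertex (`OneStepResolventKernel.vertexOf`) of the family of chain-rule vertices of the slices (the `ℋ⊗ℋ`
part of the second `B`-jet of a bordered Hessian depending on `B` through the minimiser; the second-RESPONSE part is separate). -/
noncomputable def vertex2Of (N : ℕ) [NeZero N]
    (S₂ : Fin (d + 1) → (Fin (d + 1) → ℤ) → Fin (d + 1) → (Fin (d + 1) → ℤ) → ExpKernelCalculus.MKer (d + 1) (Fib d))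
    (μ : Fin (d + 1)) (z : Fin (d + 1) → ℤ) (ν : Fin (d + 1)) (z' : Fin (d + 1) → ℤ) : ExpKernelCalculus.MKer (d + 1) (Fib d) :=
  vertexOf (N := N) (fun κ u => vertexOf (N := N) (S₂ κ u) ν z') μ z

variable {S₂ : Fin (d + 1) → (Fin (d + 1) → ℤ) → Fin (d + 1) → (Fin (d + 1) → ℤ) → ExpKernelCalculus.MKer (d + 1) (Fib d)}
  {C δ : ℝ}

/-- [folklore] The constant of a `LocStencil₂` bound is nonnegative. -/
theorem LocStencil₂.nonneg (hS₂ : LocStencil₂ S₂ C δ) : 0 ≤ C := by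
  have h := (hS₂ 0 0 0 0).nonneg (Sum.inl 0)
  simpa only [sub_self, l1_zero', mul_zero, Real.exp_zero, mul_one] using h

/-- [folklore] Every second-slot slice `u′ ↦ S₂ κ u κ′ u′ x₁ x₂ a b` of a local bi-stencil family is summable. -/
theorem summable_slice_of_locStencil₂ (hS₂ : LocStencil₂ S₂ C δ) (hδ : 0 < δ) (κ : Fin (d + 1)) (u : Fin (d + 1) → ℤ)
    (κ' : Fin (d + 1)) (x₁ x₂ : Fin (d + 1) → ℤ) (a b : Fib d) : Summable fun u' => S₂ κ u κ' u' x₁ x₂ a b :=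
  Summable.of_norm_bounded ((ExpKernelCalculus.summable_exp_shift' hδ u).mul_left
    (C * Real.exp (-δ * (l1 (x₁ - u) + l1 (x₂ - u))))) (fun u' => by
      rw [Real.norm_eq_abs]
      refine (hS₂ κ u κ' u' x₁ x₂ a b).trans_eq ?_
      ring)

/-- [folklore] The `ℓ¹` mass of a second-slot slice: `Σ'_{u′} |S₂ κ u κ′ u′ x₁ x₂ a b| ≤ C · Zl δ · e^{−δ(|x₁−u| + |x₂−u|)}`. -/
theorem tsum_abs_slice_le (hS₂ : LocStencil₂ S₂ C δ) (hδ : 0 < δ) (κ : Fin (d + 1)) (u : Fin (d + 1) → ℤ) (κ' : Fin (d + 1))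
    (x₁ x₂ : Fin (d + 1) → ℤ) (a b : Fib d) :
    ∑' u', |S₂ κ u κ' u' x₁ x₂ a b| ≤ C * Zl (d + 1) δ * Real.exp (-δ * (l1 (x₁ - u) + l1 (x₂ - u))) := by
  have hs := summable_slice_of_locStencil₂ hS₂ hδ κ u κ' x₁ x₂ a b
  calc ∑' u', |S₂ κ u κ' u' x₁ x₂ a b|
      ≤ ∑' u', C * Real.exp (-δ * (l1 (x₁ - u) + l1 (x₂ - u))) * Real.exp (-δ * l1 (u' - u)) :=
        Summable.tsum_le_tsum (fun u' => (hS₂ κ u κ' u' x₁ x₂ a b).trans_eq (by ring)) hs.abs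
          ((ExpKernelCalculus.summable_exp_shift' hδ u).mul_left _)
    _ = C * Zl (d + 1) δ * Real.exp (-δ * (l1 (x₁ - u) + l1 (x₂ - u))) := by
        rw [tsum_mul_left, ExpKernelCalculus.tsum_exp_shift']
        ring

/-- [folklore] BOUND ON THE INNER ONE-SHOT VERTEX of a slice: `|vertexOf (N := P) (S₂ κ u) ν z′ x₁ x₂ a b| ≤ (d+1)·C_ℋ·C·Zl δ ·
e^{−δ(|x₁−u| + |x₂−u|)}` (bounded minimiser columns × the `ℓ¹` mass of the slice), uniformly in the coarse bond `(ν, z′)`. -/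
theorem abs_vertexOf_slice_le {P : ℕ} [NeZero P] (hS₂ : LocStencil₂ S₂ C δ) (hδ : 0 < δ) {CH : ℝ} (hCH : 0 ≤ CH)
    (hHb : ∀ l w κ' u', |Hcol (N := P) (d := d) l w κ' u'| ≤ CH) (κ : Fin (d + 1)) (u : Fin (d + 1) → ℤ) (ν : Fin (d + 1))
    (z' : Fin (d + 1) → ℤ) (x₁ x₂ : Fin (d + 1) → ℤ) (a b : Fib d) :
    |vertexOf (N := P) (S₂ κ u) ν z' x₁ x₂ a b|
      ≤ (d + 1 : ℕ) * (CH * (C * Zl (d + 1) δ)) * Real.exp (-δ * (l1 (x₁ - u) + l1 (x₂ - u))) := by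
  show |∑ κ', ∑' u', wH (N := P) (d := d) κ' ν (u' - (P : ℤ) • z') * S₂ κ u κ' u' x₁ x₂ a b| ≤ _
  calc |∑ κ', ∑' u', wH (N := P) (d := d) κ' ν (u' - (P : ℤ) • z') * S₂ κ u κ' u' x₁ x₂ a b|
      ≤ ∑ κ', |∑' u', wH (N := P) (d := d) κ' ν (u' - (P : ℤ) • z') * S₂ κ u κ' u' x₁ x₂ a b| :=
        Finset.abs_sum_le_sum_abs _ _
    _ ≤ ∑ _κ' : Fin (d + 1), CH * (C * Zl (d + 1) δ * Real.exp (-δ * (l1 (x₁ - u) + l1 (x₂ - u)))) :=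
        Finset.sum_le_sum fun κ' _ => by
          refine (abs_tsum_mul_le (fun u' => ?_) (summable_slice_of_locStencil₂ hS₂ hδ κ u κ' x₁ x₂ a b)).trans
            (mul_le_mul_of_nonneg_left (tsum_abs_slice_le hS₂ hδ κ u κ' x₁ x₂ a b) hCH)
          have h := hHb ν z' κ' u'
          rwa [Hcol_apply] at h
    _ = (d + 1 : ℕ) * (CH * (C * Zl (d + 1) δ)) * Real.exp (-δ * (l1 (x₁ - u) + l1 (x₂ - u))) := by
        rw [Finset.sum_const, Finset.card_univ, Fintype.card_fin, nsmul_eq_mul]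
        ring

/-- [folklore] The first-slot slices of the family of inner one-shot vertices are summable (so the outer chain-rule vertex of
`vertex2Of` is a genuine absolutely convergent sum and §7's general transport theorem applies to it). -/
theorem summable_vertexOf_slice {P : ℕ} [NeZero P] (hS₂ : LocStencil₂ S₂ C δ) (hδ : 0 < δ) (κ : Fin (d + 1)) (ν : Fin (d + 1))
    (z' : Fin (d + 1) → ℤ) (x₁ x₂ : Fin (d + 1) → ℤ) (a b : Fib d) :
    Summable fun u => vertexOf (N := P) (S₂ κ u) ν z' x₁ x₂ a b := by
  obtain ⟨CH, hCH, hHb, _⟩ := Hcol_bdd_summable (N := P) (d := d)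
  have hC := hS₂.nonneg
  have hZ := (Zl_nonneg (D := d + 1) hδ)
  refine Summable.of_norm_bounded ((ExpKernelCalculus.summable_exp_shift hδ x₁).mul_left
    ((d + 1 : ℕ) * (CH * (C * Zl (d + 1) δ)))) (fun u => ?_)
  rw [Real.norm_eq_abs]
  refine (abs_vertexOf_slice_le hS₂ hδ hCH hHb κ u ν z' x₁ x₂ a b).trans (mul_le_mul_of_nonneg_left (Real.exp_le_exp.2 ?_) ?_)
  · nlinarith [l1_nonneg (x₂ - u), l1_nonneg (x₁ - u)]
  · positivity

/-- [folklore] A real-analysis interchange: bounded `H`, summable `R`, and `V u w` dominated by a summable function of `u` uniformly in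
`w` give `Σ'_u H u · Σ'_w R w · V u w = Σ'_w R w · Σ'_u H u · V u w` (`KernelWard.tsum_comm_of_prodBound`). -/
theorem tsum_mul_tsum_comm {H R : (Fin (d + 1) → ℤ) → ℝ} {V : (Fin (d + 1) → ℤ) → (Fin (d + 1) → ℤ) → ℝ} {CH K : ℝ}
    {x₁ : Fin (d + 1) → ℤ} (hH : ∀ u, |H u| ≤ CH) (hCH : 0 ≤ CH) (hR : Summable R)
    (hV : ∀ u w, |V u w| ≤ K * Real.exp (-δ * l1 (x₁ - u))) (hK : 0 ≤ K) (hδ : 0 < δ) :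
    ∑' u, H u * ∑' w, R w * V u w = ∑' w, R w * ∑' u, H u * V u w := by
  have hPB : ProdBound (fun u w => H u * (R w * V u w)) := by
    refine ⟨fun u => CH * (K * Real.exp (-δ * l1 (x₁ - u))), fun w => |R w|,
      ((ExpKernelCalculus.summable_exp_shift hδ x₁).mul_left K).mul_left CH, hR.abs, fun u => by positivity,
      fun w => abs_nonneg _, fun u w => ?_⟩
    rw [abs_mul, abs_mul]
    calc |H u| * (|R w| * |V u w|) ≤ CH * (|R w| * (K * Real.exp (-δ * l1 (x₁ - u)))) :=
          mul_le_mul (hH u) (mul_le_mul_of_nonneg_left (hV u w) (abs_nonneg _)) (by positivity) hCH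
      _ = CH * (K * Real.exp (-δ * l1 (x₁ - u))) * |R w| := by ring
  calc ∑' u, H u * ∑' w, R w * V u w = ∑' u, ∑' w, H u * (R w * V u w) := tsum_congr fun u => tsum_mul_left.symm
    _ = ∑' w, ∑' u, H u * (R w * V u w) := tsum_comm_of_prodBound hPB
    _ = ∑' w, R w * ∑' u, H u * V u w := tsum_congr fun w => by
        rw [← tsum_mul_left]
        exact tsum_congr fun u => by ring

/-- [folklore] **(K1b′ ⊗ K1b′) — THE ONE-SHOT SECOND-ORDER VERTEX TRANSPORTS ITSELF.**  For EVERY local fine bi-stencil family `S₂`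
and every commensurate pair of blockings `N′ = M·L`:
`vertex2Of N′ S₂ μ z ν z′ = InterLevelTransport.transportW M (respStep M N′) (vertex2Of M S₂) μ z ν z′` — both bond slots of the
level-`N′` one-shot second-order vertex are the (K1b′) transports of the level-`M` ones.  PROOF: §7's general theorem in each slot
(`vertexOf_eq_transportV_of_summable`, with the slice summabilities `summable_slice_of_locStencil₂` / `summable_vertexOf_slice`) and one
more dominated interchange (`tsum_mul_tsum_comm`) moving the inner transport out of the outer chain-rule sum.  CONSEQUENCE for the
composite recursion ((D-μ), P4): the `ℋ⊗ℋ` part of the composite second-order families is, like the first order (§3/§7), a recursion at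
(bi-)STENCIL level — no transport inside the jets; `transportW` belongs to the vertex-level theorem. -/
theorem vertex2Of_eq_transportW {N' M L : ℕ} [NeZero N'] [NeZero M] [NeZero L] (hN : N' = M * L)
    (hS₂ : LocStencil₂ S₂ C δ) (hδ : 0 < δ) (μ : Fin (d + 1)) (z : Fin (d + 1) → ℤ) (ν : Fin (d + 1)) (z' : Fin (d + 1) → ℤ) :
    vertex2Of N' S₂ μ z ν z' = transportW M (respStep (d := d) M N') (vertex2Of M S₂) μ z ν z' := by
  -- the two slots, by §7's general theorem
  have L1 : (fun κ u => vertexOf (N := N') (S₂ κ u) ν z')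
      = fun κ u => transportV M (respStep (d := d) M N') (vertexOf (N := M) (S₂ κ u)) ν z' := by
    funext κ u
    exact vertexOf_eq_transportV_of_summable hN
      (fun κ' x₁ x₂ a b => summable_slice_of_locStencil₂ hS₂ hδ κ u κ' x₁ x₂ a b) ν z'
  have L3 : vertex2Of N' S₂ μ z ν z'
      = transportV M (respStep (d := d) M N') (vertexOf (N := M) (fun κ u => vertexOf (N := N') (S₂ κ u) ν z')) μ z :=
    vertexOf_eq_transportV_of_summable hN (fun κ x₁ x₂ a b => summable_vertexOf_slice hS₂ hδ κ ν z' x₁ x₂ a b) μ z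
  rw [L3, L1]
  -- bounds at blocking `M`
  obtain ⟨CH, hCH, hHb, _⟩ := Hcol_bdd_summable (N := M) (d := d)
  have hC := hS₂.nonneg
  have hZ := Zl_nonneg (D := d + 1) hδ
  funext x₁ x₂ a b
  set R₁ : Fin (d + 1) → (Fin (d + 1) → ℤ) → ℝ := fun l w => respStep (d := d) M N' μ z l w with hR₁
  set R₂ : Fin (d + 1) → (Fin (d + 1) → ℤ) → ℝ := fun l' w'' => respStep (d := d) M N' ν z' l' w'' with hR₂
  set V : Fin (d + 1) → (Fin (d + 1) → ℤ) → Fin (d + 1) → (Fin (d + 1) → ℤ) → ℝ :=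
    fun κ u l' w'' => vertexOf (N := M) (S₂ κ u) l' w'' x₁ x₂ a b with hV
  set H : Fin (d + 1) → Fin (d + 1) → (Fin (d + 1) → ℤ) → (Fin (d + 1) → ℤ) → ℝ :=
    fun κ l u w => wH (N := M) (d := d) κ l (u - (M : ℤ) • w) with hH
  set K : ℝ := (d + 1 : ℕ) * (CH * (C * Zl (d + 1) δ)) with hK
  have hK0 : 0 ≤ K := by positivity
  have hR₁s : ∀ l, Summable (R₁ l) := fun l => summable_respStep (d := d) M N' μ z l
  have hR₂s : ∀ l', Summable (R₂ l') := fun l' => summable_respStep (d := d) M N' ν z' l'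
  have hHle : ∀ κ l u w, |H κ l u w| ≤ CH := fun κ l u w => by
    have h := hHb l w κ u
    rwa [Hcol_apply] at h
  have hVle : ∀ κ u l' w'', |V κ u l' w''| ≤ K * Real.exp (-δ * l1 (x₁ - u)) := fun κ u l' w'' => by
    refine (abs_vertexOf_slice_le hS₂ hδ hCH hHb κ u l' w'' x₁ x₂ a b).trans
      (mul_le_mul_of_nonneg_left (Real.exp_le_exp.2 ?_) hK0)
    nlinarith [l1_nonneg (x₂ - u), l1_nonneg (x₁ - u)]
  have hVs : ∀ κ l' w'', Summable fun u => V κ u l' w'' := fun κ l' w'' =>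
    summable_vertexOf_slice hS₂ hδ κ l' w'' x₁ x₂ a b
  -- the level-`M` second-order vertex entries `W l w l' w''` and their uniform bound
  set W : Fin (d + 1) → (Fin (d + 1) → ℤ) → Fin (d + 1) → (Fin (d + 1) → ℤ) → ℝ :=
    fun l w l' w'' => ∑ κ, ∑' u, H κ l u w * V κ u l' w'' with hW
  have hWle : ∀ l w l' w'', |W l w l' w''| ≤ (d + 1 : ℕ) * (CH * (K * Zl (d + 1) δ)) := fun l w l' w'' => by
    calc |W l w l' w''| ≤ ∑ κ, |∑' u, H κ l u w * V κ u l' w''| := Finset.abs_sum_le_sum_abs _ _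
      _ ≤ ∑ _κ : Fin (d + 1), CH * (K * Zl (d + 1) δ) := Finset.sum_le_sum fun κ _ => by
          refine (abs_tsum_mul_le (fun u => hHle κ l u w) (hVs κ l' w'')).trans (mul_le_mul_of_nonneg_left ?_ hCH)
          calc ∑' u, |V κ u l' w''| ≤ ∑' u, K * Real.exp (-δ * l1 (x₁ - u)) :=
                Summable.tsum_le_tsum (fun u => hVle κ u l' w'') (hVs κ l' w'').abs
                  ((ExpKernelCalculus.summable_exp_shift hδ x₁).mul_left K)
            _ = K * Zl (d + 1) δ := by rw [tsum_mul_left, ExpKernelCalculus.tsum_exp_shift]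
      _ = (d + 1 : ℕ) * (CH * (K * Zl (d + 1) δ)) := by
          rw [Finset.sum_const, Finset.card_univ, Fintype.card_fin, nsmul_eq_mul]
  -- LEFT side unfolded
  have lhs : transportV M (respStep (d := d) M N')
        (vertexOf (N := M) (fun κ u => transportV M (respStep (d := d) M N') (vertexOf (N := M) (S₂ κ u)) ν z')) μ z x₁ x₂ a b
      = ∑ l, ∑' w, R₁ l w * ∑ κ, ∑' u, H κ l u w * ∑ l', ∑' w'', R₂ l' w'' * V κ u l' w'' := by
    show (∑ l, cwsum M (fun w => respStep (d := d) M N' μ z l w)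
      (vertexOf (N := M) (fun κ u => transportV M (respStep (d := d) M N') (vertexOf (N := M) (S₂ κ u)) ν z') l) x₁ x₂ a b) = _
    refine Finset.sum_congr rfl fun l _ => ?_
    rw [cwsum_apply]
    refine tsum_congr fun w => ?_
    congr 1
    show (∑ κ, ∑' u, wH (N := M) (d := d) κ l (u - (M : ℤ) • w)
      * transportV M (respStep (d := d) M N') (vertexOf (N := M) (S₂ κ u)) ν z' x₁ x₂ a b) = _
    refine Finset.sum_congr rfl fun κ _ => tsum_congr fun u => ?_
    congr 1
    show (∑ l', cwsum M (fun w'' => respStep (d := d) M N' ν z' l' w'') (vertexOf (N := M) (S₂ κ u) l') x₁ x₂ a b) = _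
    refine Finset.sum_congr rfl fun l' _ => ?_
    rw [cwsum_apply]
  -- RIGHT side unfolded
  have rhs : transportW M (respStep (d := d) M N') (vertex2Of M S₂) μ z ν z' x₁ x₂ a b
      = ∑ l, ∑ l', ∑' w, R₁ l w * ∑' w'', R₂ l' w'' * W l w l' w'' := by
    show (∑ l, ∑ l', cwsum M (fun w => respStep (d := d) M N' μ z l w)
      (fun w => cwsum M (fun w'' => respStep (d := d) M N' ν z' l' w'') (fun w'' => vertex2Of M S₂ l w l' w'')) x₁ x₂ a b) = _
    refine Finset.sum_congr rfl fun l _ => Finset.sum_congr rfl fun l' _ => ?_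
    rw [cwsum_apply]
    refine tsum_congr fun w => ?_
    rw [cwsum_apply]
    congr 1
  -- per `(l, w)`: move the inner transport out of the outer chain-rule sum
  have inner : ∀ l w, (∑ κ, ∑' u, H κ l u w * ∑ l', ∑' w'', R₂ l' w'' * V κ u l' w'')
      = ∑ l', ∑' w'', R₂ l' w'' * W l w l' w'' := by
    intro l w
    -- pull the finite `l'` sum out of the `u` series, then interchange `u` and `w''`
    have hsu : ∀ κ, ∀ l' ∈ (Finset.univ : Finset (Fin (d + 1))),
        Summable fun u => H κ l u w * ∑' w'', R₂ l' w'' * V κ u l' w'' := fun κ l' _ => by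
      refine summable_mul_of_bdd (fun u => hHle κ l u w) ?_
      refine Summable.of_norm_bounded ((ExpKernelCalculus.summable_exp_shift hδ x₁).mul_left
        ((∑' w'', |R₂ l' w''|) * K)) (fun u => ?_)
      rw [Real.norm_eq_abs]
      have h1 : |∑' w'', R₂ l' w'' * V κ u l' w''| ≤ (∑' w'', |R₂ l' w''|) * (K * Real.exp (-δ * l1 (x₁ - u))) := by
        have hs : Summable fun w'' => R₂ l' w'' * V κ u l' w'' := summable_mul_of_bdd' (hR₂s l') (fun w'' => hVle κ u l' w'')
        calc |∑' w'', R₂ l' w'' * V κ u l' w''| ≤ ∑' w'', |R₂ l' w'' * V κ u l' w''| := by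
              have h := norm_tsum_le_tsum_norm hs.norm
              simpa only [Real.norm_eq_abs] using h
          _ ≤ ∑' w'', |R₂ l' w''| * (K * Real.exp (-δ * l1 (x₁ - u))) :=
              Summable.tsum_le_tsum (fun w'' => by
                rw [abs_mul]; exact mul_le_mul_of_nonneg_left (hVle κ u l' w'') (abs_nonneg _)) hs.abs
                ((hR₂s l').abs.mul_right _)
          _ = (∑' w'', |R₂ l' w''|) * (K * Real.exp (-δ * l1 (x₁ - u))) := tsum_mul_right
      calc _ ≤ _ := h1
        _ = _ := by ring
    calc (∑ κ, ∑' u, H κ l u w * ∑ l', ∑' w'', R₂ l' w'' * V κ u l' w'')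
        = ∑ κ, ∑ l', ∑' u, H κ l u w * ∑' w'', R₂ l' w'' * V κ u l' w'' := Finset.sum_congr rfl fun κ _ => by
          rw [← Summable.tsum_finsetSum (hsu κ)]
          exact tsum_congr fun u => Finset.mul_sum _ _ _
      _ = ∑ κ, ∑ l', ∑' w'', R₂ l' w'' * ∑' u, H κ l u w * V κ u l' w'' :=
          Finset.sum_congr rfl fun κ _ => Finset.sum_congr rfl fun l' _ =>
            tsum_mul_tsum_comm (fun u => hHle κ l u w) hCH (hR₂s l') (fun u w'' => hVle κ u l' w'') hK0 hδ
      _ = ∑ l', ∑ κ, ∑' w'', R₂ l' w'' * ∑' u, H κ l u w * V κ u l' w'' := Finset.sum_comm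
      _ = ∑ l', ∑' w'', R₂ l' w'' * W l w l' w'' := Finset.sum_congr rfl fun l' _ => by
          have hs : ∀ κ ∈ (Finset.univ : Finset (Fin (d + 1))),
              Summable fun w'' => R₂ l' w'' * ∑' u, H κ l u w * V κ u l' w'' := fun κ _ =>
            summable_mul_of_bdd' (hR₂s l') (fun w'' => by
              refine (abs_tsum_mul_le (fun u => hHle κ l u w) (hVs κ l' w'')).trans ?_
              exact mul_le_mul_of_nonneg_left (by
                calc ∑' u, |V κ u l' w''| ≤ ∑' u, K * Real.exp (-δ * l1 (x₁ - u)) :=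
                      Summable.tsum_le_tsum (fun u => hVle κ u l' w'') (hVs κ l' w'').abs
                        ((ExpKernelCalculus.summable_exp_shift hδ x₁).mul_left K)
                  _ = K * Zl (d + 1) δ := by rw [tsum_mul_left, ExpKernelCalculus.tsum_exp_shift]) hCH)
          rw [← Summable.tsum_finsetSum hs]
          exact tsum_congr fun w'' => by rw [hW, Finset.mul_sum]
  rw [lhs, rhs]
  refine Finset.sum_congr rfl fun l _ => ?_
  -- per `l`: substitute `inner`, then pull the finite `l'` sum out of the `w` series
  have hsw : ∀ l' ∈ (Finset.univ : Finset (Fin (d + 1))),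
      Summable fun w => R₁ l w * ∑' w'', R₂ l' w'' * W l w l' w'' := fun l' _ => by
    have hb : ∀ w, |∑' w'', R₂ l' w'' * W l w l' w''| ≤ (d + 1 : ℕ) * (CH * (K * Zl (d + 1) δ)) * ∑' w'', |R₂ l' w''| :=
      fun w => by
        have h := abs_tsum_mul_le (H := fun w'' => W l w l' w'') (T := R₂ l') (fun w'' => hWle l w l' w'') (hR₂s l')
        calc |∑' w'', R₂ l' w'' * W l w l' w''| = |∑' w'', W l w l' w'' * R₂ l' w''| := by
              congr 1
              exact tsum_congr fun w'' => mul_comm _ _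
          _ ≤ _ := h
    exact summable_mul_of_bdd' (hR₁s l) hb
  calc (∑' w, R₁ l w * ∑ κ, ∑' u, H κ l u w * ∑ l', ∑' w'', R₂ l' w'' * V κ u l' w'')
      = ∑' w, R₁ l w * ∑ l', ∑' w'', R₂ l' w'' * W l w l' w'' := tsum_congr fun w => by rw [inner l w]
    _ = ∑' w, ∑ l', R₁ l w * ∑' w'', R₂ l' w'' * W l w l' w'' := tsum_congr fun w => Finset.mul_sum _ _ _
    _ = ∑ l', ∑' w, R₁ l w * ∑' w'', R₂ l' w'' * W l w l' w'' := Summable.tsum_finsetSum hsw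

/-- [folklore] **THE CONSECUTIVE-LEVEL INSTANCE, SECOND ORDER**: `vertex2Of (Lc^{j+1}) S₂ = transportW (Lc^j) (respStep (Lc^j) (Lc^{j+1}))
(vertex2Of (Lc^j) S₂)`. -/
theorem vertex2Of_pow_succ (Lc : ℕ) [NeZero Lc] (hS₂ : LocStencil₂ S₂ C δ) (hδ : 0 < δ) (j : ℕ) (μ : Fin (d + 1)) (z : Fin (d + 1) → ℤ) (ν : Fin (d + 1))
    (z' : Fin (d + 1) → ℤ) :
    vertex2Of (Lc ^ (j + 1)) S₂ μ z ν z'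
      = transportW (Lc ^ j) (respStep (d := d) (Lc ^ j) (Lc ^ (j + 1))) (vertex2Of (Lc ^ j) S₂) μ z ν z' :=
  vertex2Of_eq_transportW (pow_succ Lc j) hS₂ hδ μ z ν z'

end SecondOrder

/-! ## §10 Localisation of the one-shot second-order vertex: the `JetData.loc₂` socket (`VertexFamily₂`) -/

section SecondOrderLoc

variable {S₂ : Fin (d + 1) → (Fin (d + 1) → ℤ) → Fin (d + 1) → (Fin (d + 1) → ℤ) → ExpKernelCalculus.MKer (d + 1) (Fib d)}
  {C δ : ℝ}

/-- [folklore] A `LocStencil₂` bound weakens to a smaller rate (both the localisation and the bond-separation decay). -/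
theorem LocStencil₂.mono (h : LocStencil₂ S₂ C δ) {m : ℝ} (hm : m ≤ δ) : LocStencil₂ S₂ C m := by
  have hC := h.nonneg
  intro κ u κ' u' x z a b
  refine (h κ u κ' u' x z a b).trans ?_
  have h1 : Real.exp (-δ * l1 (u' - u)) ≤ Real.exp (-m * l1 (u' - u)) :=
    Real.exp_le_exp.2 (by nlinarith [l1_nonneg (u' - u)])
  have h2 : Real.exp (-δ * (l1 (x - u) + l1 (z - u))) ≤ Real.exp (-m * (l1 (x - u) + l1 (z - u))) :=
    Real.exp_le_exp.2 (by nlinarith [l1_nonneg (x - u), l1_nonneg (z - u)])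
  exact mul_le_mul (mul_le_mul_of_nonneg_left h1 hC) h2 (Real.exp_pos _).le (by positivity)

/-- [folklore] **WEIGHTED SUM, FAR CENTRE**: weights decaying from `q`, kernels all bi-localised at a FIXED `p` with constants decaying
in the distance of the summation variable from `p` ⟹ the weighted sum is bi-localised at `p` with a constant decaying in `|p − q|`
(`e^{−m|u′−q|} e^{−m|u′−p|} ≤ e^{−(m/2)|p−q|} e^{−(m/2)|u′−q|}`, `ExpKernelCalculus.exp_mid`). -/
theorem biLoc_wsum_far {w : (Fin (d + 1) → ℤ) → ℝ} {K : (Fin (d + 1) → ℤ) → ExpKernelCalculus.MKer (d + 1) (Fib d)}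
    {Cw Ck m δ' : ℝ} {p q : Fin (d + 1) → ℤ} (hw : ∀ u', |w u'| ≤ Cw * Real.exp (-m * l1 (u' - q)))
    (hK : ∀ u', BiLoc (K u') p p (Ck * Real.exp (-m * l1 (u' - p))) δ') (hm : 0 < m) (hCw : 0 ≤ Cw) (hCk : 0 ≤ Ck) :
    BiLoc (wsum w K) p p (Cw * Ck * Zl (d + 1) (m / 2) * Real.exp (-(m / 2) * l1 (p - q))) δ' := by
  intro x z a b
  show |∑' u', w u' * K u' x z a b| ≤ _
  have hs := (ExpKernelCalculus.summable_exp_shift' (half_pos hm) q).mul_left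
    (Cw * Ck * Real.exp (-δ' * (l1 (x - p) + l1 (z - p))) * Real.exp (-(m / 2) * l1 (p - q)))
  have hb := tsum_of_norm_bounded hs.hasSum (fun u' => by
    rw [Real.norm_eq_abs, abs_mul]
    have h1 := hw u'
    have h2 := hK u' x z a b
    have h3 := ExpKernelCalculus.exp_mid hm.le u' q p
    rw [l1_sub_symm q p] at h3
    calc |w u'| * |K u' x z a b|
        ≤ (Cw * Real.exp (-m * l1 (u' - q)))
            * (Ck * Real.exp (-m * l1 (u' - p)) * Real.exp (-δ' * (l1 (x - p) + l1 (z - p)))) :=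
          mul_le_mul h1 h2 (abs_nonneg _) (by positivity)
      _ = Cw * Ck * Real.exp (-δ' * (l1 (x - p) + l1 (z - p))) * Real.exp (-m * (l1 (u' - q) + l1 (u' - p))) := by
          rw [mul_add (-m), Real.exp_add]
          ring
      _ ≤ Cw * Ck * Real.exp (-δ' * (l1 (x - p) + l1 (z - p)))
            * (Real.exp (-(m / 2) * l1 (p - q)) * Real.exp (-(m / 2) * l1 (u' - q))) :=
          mul_le_mul_of_nonneg_left h3 (by positivity)
      _ = _ := by ring)
  rw [Real.norm_eq_abs] at hb
  refine hb.trans (le_of_eq ?_)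
  rw [tsum_mul_left, ExpKernelCalculus.tsum_exp_shift']
  ring

/-- [folklore] **WEIGHTED SUM, TWO CENTRES**: weights decaying from `p′`, kernels bi-localised at the summation variable with constants
decaying in its distance from `q′` ⟹ the weighted sum is bi-localised at the PAIR `(p′, q′)` at a quarter of the rate. -/
theorem biLoc_wsum_two {w : (Fin (d + 1) → ℤ) → ℝ} {K : (Fin (d + 1) → ℤ) → ExpKernelCalculus.MKer (d + 1) (Fib d)}
    {Cw Ck m : ℝ} {p' q' : Fin (d + 1) → ℤ} (hw : ∀ u, |w u| ≤ Cw * Real.exp (-m * l1 (u - p')))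
    (hK : ∀ u, BiLoc (K u) u u (Ck * Real.exp (-m * l1 (u - q'))) m) (hm : 0 < m) (hCw : 0 ≤ Cw) (hCk : 0 ≤ Ck) :
    BiLoc (wsum w K) p' q' (Cw * Ck * Zl (d + 1) (m / 4)) (m / 4) := by
  intro x z a b
  show |∑' u, w u * K u x z a b| ≤ _
  have hm4 : 0 < m / 4 := by positivity
  have hs := (ExpKernelCalculus.summable_exp_shift' hm4 p').mul_left
    (Cw * Ck * Real.exp (-(m / 4) * (l1 (x - p') + l1 (z - q'))))
  have hb := tsum_of_norm_bounded hs.hasSum (fun u => by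
    rw [Real.norm_eq_abs, abs_mul]
    have h1 := hw u
    have h2 := hK u x z a b
    have hexp : Real.exp (-m * l1 (u - p')) * (Real.exp (-m * l1 (u - q')) * Real.exp (-m * (l1 (x - u) + l1 (z - u))))
        ≤ Real.exp (-(m / 4) * (l1 (x - p') + l1 (z - q'))) * Real.exp (-(m / 4) * l1 (u - p')) := by
      rw [← Real.exp_add, ← Real.exp_add, ← Real.exp_add, Real.exp_le_exp]
      have t1 := l1_sub_triangle x u p'
      have t2 := l1_sub_triangle z u q'
      have n1 := l1_nonneg (x - u)
      have n2 := l1_nonneg (z - u)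
      have n3 := l1_nonneg (u - p')
      have n4 := l1_nonneg (u - q')
      nlinarith [mul_nonneg hm.le (show 0 ≤ l1 (x - u) + l1 (u - p') - l1 (x - p') by linarith),
        mul_nonneg hm.le (show 0 ≤ l1 (z - u) + l1 (u - q') - l1 (z - q') by linarith),
        mul_nonneg hm.le n1, mul_nonneg hm.le n2, mul_nonneg hm.le n3, mul_nonneg hm.le n4]
    calc |w u| * |K u x z a b|
        ≤ (Cw * Real.exp (-m * l1 (u - p')))
            * (Ck * Real.exp (-m * l1 (u - q')) * Real.exp (-m * (l1 (x - u) + l1 (z - u)))) :=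
          mul_le_mul h1 h2 (abs_nonneg _) (by positivity)
      _ = Cw * Ck * (Real.exp (-m * l1 (u - p'))
            * (Real.exp (-m * l1 (u - q')) * Real.exp (-m * (l1 (x - u) + l1 (z - u))))) := by ring
      _ ≤ Cw * Ck * (Real.exp (-(m / 4) * (l1 (x - p') + l1 (z - q'))) * Real.exp (-(m / 4) * l1 (u - p'))) :=
          mul_le_mul_of_nonneg_left hexp (by positivity)
      _ = _ := by ring)
  rw [Real.norm_eq_abs] at hb
  refine hb.trans (le_of_eq ?_)
  rw [tsum_mul_left, ExpKernelCalculus.tsum_exp_shift']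
  ring

/-- [folklore] **THE INNER ONE-SHOT VERTEX OF A SLICE IS A FAR-CENTRED STENCIL**: for a local bi-stencil family at rate `m` and minimiser
columns decaying at rate `m`, `vertexOf (N := N) (S₂ κ u) ν y′` is bi-localised at the first bond `u` with constant
`(d+1)·C_w·C·Zl(m/2) · e^{−(m/2)|u − N•y′|}`. -/
theorem biLoc_vertexOf_slice {N : ℕ} [NeZero N] {m : ℝ} (hS₂ : LocStencil₂ S₂ C m) (hm : 0 < m) {Cw : ℝ} (hCw : 0 ≤ Cw)
    (hwH : ∀ (κ l : Fin (d + 1)) (v : Fin (d + 1) → ℤ), |wH (N := N) (d := d) κ l v| ≤ Cw * Real.exp (-m * l1 v))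
    (κ : Fin (d + 1)) (u : Fin (d + 1) → ℤ) (ν : Fin (d + 1)) (y' : Fin (d + 1) → ℤ) :
    BiLoc (vertexOf (N := N) (S₂ κ u) ν y') u u
      ((d + 1 : ℕ) * (Cw * C * Zl (d + 1) (m / 2) * Real.exp (-(m / 2) * l1 (u - (N : ℤ) • y')))) m := by
  have hC := hS₂.nonneg
  have hterm : ∀ κ' : Fin (d + 1), BiLoc (wsum (fun u' => wH (N := N) (d := d) κ' ν (u' - (N : ℤ) • y')) (S₂ κ u κ'))
      u u (Cw * C * Zl (d + 1) (m / 2) * Real.exp (-(m / 2) * l1 (u - (N : ℤ) • y'))) m := fun κ' =>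
    biLoc_wsum_far (fun u' => hwH κ' ν (u' - (N : ℤ) • y')) (fun u' => hS₂ κ u κ' u') hm hCw hC
  have hsum := biLoc_finset_sum (Finset.univ : Finset (Fin (d + 1))) (fun κ' _ => hterm κ')
  simp only [Finset.sum_const, Finset.card_univ, Fintype.card_fin, nsmul_eq_mul] at hsum
  exact hsum

/-- [folklore] **LOCALISATION OF THE ONE-SHOT SECOND-ORDER VERTEX, EXPLICIT CONSTANTS**: for a local bi-stencil family at rate `m` and
minimiser columns decaying at rate `m`, `vertex2Of N S₂` is a `VertexFamily₂` at blocking `N` at rate `m/8`. -/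
theorem vertexFamily₂_vertex2Of {N : ℕ} [NeZero N] {m : ℝ} (hS₂ : LocStencil₂ S₂ C m) (hm : 0 < m) {Cw : ℝ} (hCw : 0 ≤ Cw)
    (hwH : ∀ (κ l : Fin (d + 1)) (v : Fin (d + 1) → ℤ), |wH (N := N) (d := d) κ l v| ≤ Cw * Real.exp (-m * l1 v)) :
    VertexFamily₂ (vertex2Of N S₂) N
      ((d + 1 : ℕ) * (Cw * ((d + 1 : ℕ) * (Cw * C * Zl (d + 1) (m / 2))) * Zl (d + 1) (m / 8))) (m / 8) := by
  intro μ y ν y'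
  have hC := hS₂.nonneg
  have hZ2 := Zl_nonneg (D := d + 1) (half_pos hm)
  have hK₁ : 0 ≤ (d + 1 : ℕ) * (Cw * C * Zl (d + 1) (m / 2)) := by positivity
  -- inner slices, weakened to rate `m/2`
  have hin : ∀ (κ : Fin (d + 1)) (u : Fin (d + 1) → ℤ), BiLoc (vertexOf (N := N) (S₂ κ u) ν y') u u
      ((d + 1 : ℕ) * (Cw * C * Zl (d + 1) (m / 2)) * Real.exp (-(m / 2) * l1 (u - (N : ℤ) • y'))) (m / 2) := by
    intro κ u
    have h := biLoc_vertexOf_slice hS₂ hm hCw hwH κ u ν y'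
    rw [← mul_assoc] at h
    exact biLoc_mono h (by positivity) (by linarith)
  -- outer weights, weakened to rate `m/2`
  have hw : ∀ (κ : Fin (d + 1)) (u : Fin (d + 1) → ℤ),
      |wH (N := N) (d := d) κ μ (u - (N : ℤ) • y)| ≤ Cw * Real.exp (-(m / 2) * l1 (u - (N : ℤ) • y)) :=
    fun κ u => bound_mono (hwH κ μ _) hCw le_rfl (by linarith) (l1_nonneg _)
  have hterm : ∀ κ : Fin (d + 1), BiLoc (wsum (fun u => wH (N := N) (d := d) κ μ (u - (N : ℤ) • y))
      (fun u => vertexOf (N := N) (S₂ κ u) ν y')) ((N : ℤ) • y) ((N : ℤ) • y')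
      (Cw * ((d + 1 : ℕ) * (Cw * C * Zl (d + 1) (m / 2))) * Zl (d + 1) (m / 2 / 4)) (m / 2 / 4) := fun κ =>
    biLoc_wsum_two (hw κ) (hin κ) (half_pos hm) hCw hK₁
  have hsum := biLoc_finset_sum (Finset.univ : Finset (Fin (d + 1))) (fun κ _ => hterm κ)
  simp only [Finset.sum_const, Finset.card_univ, Fintype.card_fin, nsmul_eq_mul] at hsum
  have e : m / 2 / 4 = m / 8 := by ring
  rw [e] at hsum
  exact hsum

/-- [folklore] **THE `JetData.loc₂` SOCKET FOR `ℋ⊗ℋ` TABLES** (packaged form): for every local fine bi-stencil family, the one-shot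
second-order vertex `vertex2Of N S₂` is a bi-localised vertex family at blocking `N` — SOME constant and rate work (the rate of the
minimiser columns `decay_wH` matched by monotonicity), so `vertex2Of N S₂` may populate the `W`-slot of a `JetData d N`. -/
theorem vertexFamily₂_vertex2Of' {N : ℕ} [NeZero N] (hS₂ : LocStencil₂ S₂ C δ) (hδ : 0 < δ) :
    ∃ Cv δv : ℝ, 0 < δv ∧ VertexFamily₂ (vertex2Of N S₂) N Cv δv := by
  obtain ⟨δw, Cw, hδw, hwH⟩ := decay_wH (N := N) (d := d)
  have hCw : 0 ≤ Cw := by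
    have h0 := hwH 0 0 0
    rw [l1_zero', mul_zero, Real.exp_zero, mul_one] at h0
    exact (abs_nonneg _).trans h0
  have hm : 0 < min δ δw := lt_min hδ hδw
  have hS' : LocStencil₂ S₂ C (min δ δw) := hS₂.mono (min_le_left _ _)
  have hwH' : ∀ (κ l : Fin (d + 1)) (v : Fin (d + 1) → ℤ), |wH (N := N) (d := d) κ l v| ≤ Cw * Real.exp (-(min δ δw) * l1 v) :=
    fun κ l v => bound_mono (hwH κ l v) hCw le_rfl (min_le_right _ _) (l1_nonneg _)
  exact ⟨_, _, by positivity, vertexFamily₂_vertex2Of hS' hm hCw hwH'⟩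

end SecondOrderLoc

/-! ## §8 (`d = 3`) The (K1b′) response family IS an4's canonical transport weight `wStep` read at the relative position -/

section WStep

variable (Lc : ℕ) [NeZero Lc]

/-- [folklore] **`respStep (Lc^j) (Lc^{j+1}) μ z l″ w′ = wStep Lc j l″ μ (Lc•z − w′)`** (`d = 3`): the (K1b′) response of the
level-`Lc^j` bond `(l″, w′)` to the level-`Lc^{j+1}` bond `(μ, z)` is an4's `Lc^{5j}`-normalised `ℋ`-column pattern
`HessianTelescopingKKT.wStep Lc j` (= the lead's `StepDriftWitness.respBond Lc j` WITHOUT its bond-unit factor `Lc^4`) at the relative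
position `Lc•z − w′` on the `Lc^j`-lattice — `stepCol_eq` + `sum_LegIdx_eq_contourSum` + the cancellation `Lc^{5j}·((Lc^j)^5)⁻¹ = 1`;
the translation by `Lc•z` is absorbed because the `(inl, inr)` block of `KInv` depends on the difference of its arguments only.  So the
vertex-level transport of §7 between consecutive composite levels runs with EXACTLY the weight the road's step recursion (R1) is stated
with (`HessianTelescopingKKT.StepRecursionUpTo … (wStep Lc)`), up to the jets' own bond-unit rescaling (UNITS, module docstring). -/
theorem respStep_eq_wStep (j : ℕ) (μ : Fin 4) (z : Fin 4 → ℤ) (l'' : Fin 4) (w' : Fin 4 → ℤ) :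
    respStep (d := 3) (Lc ^ j) (Lc ^ (j + 1)) μ z l'' w' = wStep Lc j l'' μ (((Lc : ℕ) : ℤ) • z - w') := by
  have hL : (Lc : ℝ) ≠ 0 := by exact_mod_cast NeZero.ne Lc
  have hpow : (Lc : ℝ) ^ (5 * j) * ((((Lc ^ j : ℕ) : ℝ)) ^ (3 + 2))⁻¹ = 1 := by
    push_cast
    rw [← pow_mul, show j * (3 + 2) = 5 * j by ring, mul_inv_cancel₀ (pow_ne_zero _ hL)]
  unfold respStep
  rw [← sum_LegIdx_eq_contourSum]
  show (∑ i ∈ LegIdx 3 (Lc ^ j), Hcol (N := Lc ^ (j + 1)) (d := 3) μ z l'' (legPt (Lc ^ j) (Sum.inl l'') w' i))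
    = (Lc : ℝ) ^ (5 * j) * stepCol (d := 3) Lc j l'' μ (((Lc : ℕ) : ℤ) • z - w')
  rw [stepCol_eq, Finset.mul_sum]
  refine Finset.sum_congr rfl fun i _ => ?_
  rw [← mul_assoc, hpow, one_mul, Hcol_apply]
  congr 1
  funext k
  simp only [legPt, legOff, Pi.sub_apply, Pi.add_apply, Pi.smul_apply, smul_eq_mul]
  push_cast
  ring

/-- [folklore] **CONSECUTIVE COMPOSITE LEVELS TRANSPORT WITH `wStep`** (`d = 3`): for every local stencil family `S`,
`vertexOf (N := Lc^{j+1}) S μ z = Σ_{l″} Σ'_{w′} wStep Lc j l″ μ (Lc•z − w′) • vertexOf (N := Lc^j) S l″ w′`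
(`vertexOf_pow_succ` with `respStep_eq_wStep`). -/
theorem vertexOf_pow_succ_wStep {S : Fin 4 → (Fin 4 → ℤ) → ExpKernelCalculus.MKer 4 (Fib 3)} {Cs δ : ℝ}
    (hS : LocStencil S Cs δ) (hδ : 0 < δ) (j : ℕ) (μ : Fin 4) (z : Fin 4 → ℤ) :
    vertexOf (N := Lc ^ (j + 1)) S μ z
      = transportV (Lc ^ j) (fun μ z l'' w' => wStep Lc j l'' μ (((Lc : ℕ) : ℤ) • z - w')) (vertexOf (N := Lc ^ j) S) μ z := by
  rw [vertexOf_pow_succ Lc hS hδ j μ z]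
  have e : respStep (d := 3) (Lc ^ j) (Lc ^ (j + 1)) = fun μ z l'' w' => wStep Lc j l'' μ (((Lc : ℕ) : ℤ) • z - w') := by
    funext μ z l'' w'
    exact respStep_eq_wStep Lc j μ z l'' w'
  rw [e]

/-- [folklore] **THE LEAD'S RESPONSE SLOT IN TWO SPELLINGS** (`d = 3`): `StepDriftWitness.respBond Lc j μ z l″ w′ = Lc^4 · respStep (Lc^j)
(Lc^{j+1}) μ z l″ w′` — (R26-1)'s `respBond` is the (K1b′) weight times the bond-unit factor `Lc^{d+1} = Lc^4` (`respBond_eq_wStep` and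
`respStep_eq_wStep`). -/
theorem respBond_eq_mul_respStep (j : ℕ) (μ : Fin 4) (z : Fin 4 → ℤ) (l'' : Fin 4) (w' : Fin 4 → ℤ) :
    StepDriftWitness.respBond Lc j μ z l'' w' = (Lc : ℝ) ^ 4 * respStep (d := 3) (Lc ^ j) (Lc ^ (j + 1)) μ z l'' w' := by
  rw [StepDriftWitness.respBond_eq_wStep, respStep_eq_wStep]

/-- [folklore] **WHAT THE ROAD'S TRANSPORT DOES TO A ONE-SHOT VERTEX FAMILY** (`d = 3`; IDENT-122-CHECKLIST row «units of the
response»): transporting the level-`Lc^j` one-shot chain-rule vertex family of ANY local stencil family `S` by the lead's response slot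
`respBond Lc j` (`InterLevelTransport.transportV`) gives `Lc^4 •` the level-`Lc^{j+1}` one-shot chain-rule vertex family of the SAME
stencil family: `transportV (Lc^j) (respBond Lc j) (vertexOf (N := Lc^j) S) μ z = Lc^4 • vertexOf (N := Lc^{j+1}) S μ z`.  So along the
road's transport the composite first-order structure changes ONLY through the stencil recursion `Sc` (§3) and the bond-unit factor
`Lc^{d+1}` — the first exponent of `Sc_succ` (UNITS, module docstring). -/
theorem transportV_respBond_vertexOf {S : Fin 4 → (Fin 4 → ℤ) → ExpKernelCalculus.MKer 4 (Fib 3)} {Cs δ : ℝ}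
    (hS : LocStencil S Cs δ) (hδ : 0 < δ) (j : ℕ) (μ : Fin 4) (z : Fin 4 → ℤ) :
    transportV (Lc ^ j) (StepDriftWitness.respBond Lc j) (vertexOf (N := Lc ^ j) S) μ z
      = ((Lc : ℝ) ^ 4) • vertexOf (N := Lc ^ (j + 1)) S μ z := by
  rw [vertexOf_pow_succ Lc hS hδ j μ z]
  funext x w a b
  simp only [transportV, Pi.smul_apply, smul_eq_mul, cwsum_apply, respBond_eq_mul_respStep, mul_assoc]
  rw [Finset.mul_sum]
  refine Finset.sum_congr rfl fun l _ => ?_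
  rw [← tsum_mul_left]

/-- [folklore] **WHAT THE ROAD'S TRANSPORT DOES TO A ONE-SHOT SECOND-ORDER VERTEX FAMILY** (`d = 3`): transporting BOTH slots of the
level-`Lc^j` one-shot second-order vertex of ANY local bi-stencil family by the lead's response slot `respBond Lc j`
(`InterLevelTransport.transportW`) gives `Lc^8 •` the level-`Lc^{j+1}` one — one bond-unit factor `Lc^{d+1} = Lc^4` per slot:
`transportW (Lc^j) (respBond Lc j) (vertex2Of (Lc^j) S₂) = Lc^8 • vertex2Of (Lc^{j+1}) S₂`. -/
theorem transportW_respBond_vertex2Of {S₂ : Fin 4 → (Fin 4 → ℤ) → Fin 4 → (Fin 4 → ℤ) → ExpKernelCalculus.MKer 4 (Fib 3)} {C δ : ℝ}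
    (hS₂ : LocStencil₂ S₂ C δ) (hδ : 0 < δ) (j : ℕ) (μ : Fin 4) (z : Fin 4 → ℤ) (ν : Fin 4) (z' : Fin 4 → ℤ) :
    transportW (Lc ^ j) (StepDriftWitness.respBond Lc j) (vertex2Of (Lc ^ j) S₂) μ z ν z'
      = ((Lc : ℝ) ^ 8) • vertex2Of (Lc ^ (j + 1)) S₂ μ z ν z' := by
  rw [vertex2Of_pow_succ Lc hS₂ hδ j μ z ν z']
  funext x w a b
  simp only [transportW, Pi.smul_apply, smul_eq_mul, cwsum_apply, respBond_eq_mul_respStep]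
  rw [Finset.mul_sum]
  refine Finset.sum_congr rfl fun l _ => ?_
  rw [Finset.mul_sum]
  refine Finset.sum_congr rfl fun l' _ => ?_
  rw [← tsum_mul_left]
  refine tsum_congr fun y' => ?_
  have h : (∑' y'', (Lc : ℝ) ^ 4 * respStep (d := 3) (Lc ^ j) (Lc ^ (j + 1)) ν z' l' y''
        * vertex2Of (Lc ^ j) S₂ l y' l' y'' x w a b)
      = (Lc : ℝ) ^ 4 * ∑' y'', respStep (d := 3) (Lc ^ j) (Lc ^ (j + 1)) ν z' l' y''
        * vertex2Of (Lc ^ j) S₂ l y' l' y'' x w a b := by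
    rw [← tsum_mul_left]
    exact tsum_congr fun y'' => mul_assoc _ _ _
  rw [h]
  ring

end WStep

end Literature.MathematicalPhysics.QuantumFieldTheory.Balaban1983to89.Beta.BalabanCompositeJets

end
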